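import Literature.NumberTheory.LFunctions.SuzukiWeilHilbertSpaceDefs
import Literature.NumberTheory.LFunctions.RiemannXiProofs
import Literature.NumberTheory.LFunctions.WeilZeroSum
import Literature.NumberTheory.LFunctions.WeilExplicitProofs
import Literature.NumberTheory.LFunctions.WeilExplicitFormulaProofs
import Literature.NumberTheory.LFunctions.SuzukiScrewLine
import Literature.NumberTheory.LFunctions.WeilCriterionProofs
import Literature.Analysis.FunctionSpaces.PlancherelL1L2
import HarnessLib
import Summits.RiemannHypothesis.RiemannHypothesis.Theorems.WeilPositivity

/-!
# Suzuki's Hilbert space `V(0)` derived from the Weil distribution — the theorems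

LINE 1 — LABELS. The theorems about the OBJECTS (`𝖪` is an isometric involution of `L²(ℝ)`, the
spaces `V(t) = L²(t,∞) ∩ 𝖪L²(t,∞)` are closed `ℂ`-subspaces, totally ordered and `𝖪`-invariant,
Suzuki's Weil hermitian form on `C_c^∞(ℝ)` IS the tree's Weil functional of COLUMN 2) are RH-FREE
and PROVED here. The statements printed "Assume that the RH is true" (M. Suzuki, *On the Hilbert
space derived from the Weil distribution*, Canad. J. Math. (2025), doi:10.4153/S0008414X25101739 =
arXiv:2301.00421v3 — the VERSION OF RECORD, cited `CJM`; Lemma 5.1, Lemma 5.3, Thm. 5.5, Thm. 5.7,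
the orthogonal basis of Prop. 4.1/(5.11)) are RH-CONSEQUENCES, typed as named facts
`RiemannHypothesis → …` (published theorems, not discharge targets of this cell). Prop. 5.8
(= arXiv v1 Thm. 1.3) `RiemannHypothesis ↔ (1) ∧ (2)` is RH-EQUIVALENT·PRINTED (l.1); its
RH-FREE half `(1) ∧ (2) → RH` is the cell's door, PROVED Summits-side
(`Summit.RiemannHypothesis.RiemannHypothesis.Theorems.DeBrangesChain.chainDoorV0_proof`, whose
statement `ChainDoorV0` has exactly the signature of the hypothesis `hdoor` of
`Suzuki2025_prop58_of` below — not re-declared here, dedup by signature). bears_on: LADDER-RH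
B-C/B-P (COLUMN 6 DBR); L-C/L-P (COLUMN 4 LI) only through CJM Cor. 4.6 (record, see below).
WHAT THIS IS NOT: not a route and not a proof plan for RH; typing this corpus fixes WHICH identity
on the RH-free space `V(0)` would prove RH through Suzuki's door — it does not move RH; no
positivity and no Hermite–Biehler property of `E_ξ` is asserted; nothing here bears on the truth
of RH.

## Source, version of record, concordance

The objects are those of `Literature/NumberTheory/LFunctions/SuzukiWeilHilbertSpaceDefs.lean`
(`lagariasE`, `lagariasTheta`, `suzukiZeroParam` (`γ(ρ) = i(ρ − 1/2)`), `suzukiJ`, `suzukiM`,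
`suzukiK`, `halfLineL2`, `suzukiV`, `upperHalfHat`, `HasHatValue`, `WeilNormIdentityOn`,
`ZeroSeparationOn`), typed from the held text `paper:arxiv-2301.00421` (= arXiv v1/v2, bib key
`Suzuki2025WeilHilbertSpace`). The accepted text (arXiv v3 = CJM, authors' TeX held by the cell as
`dbl/src/Suzuki2025CJM_arXiv2301.00421v3.tex`) is a rewrite that absorbs the preprint
arXiv:2209.04658 and RENUMBERS; every cite below carries the CJM number and the v1 number:

| arXiv v1 (held `paper:`) | CJM 2025 (version of record) | here |
|---|---|---|
| §1 p. 2: `𝖪`, `V(t)`, "𝖪 isometric, 𝖪² = id" | §5 (5.1)–(5.2), p. 13 (TeX l.1425–1451) | `norm_suzukiK`, `suzukiK_suzukiK`, `isClosed_suzukiV`, `suzukiV_antitone`, `suzukiVSubmodule` — PROVED |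
| (1.1) `⟨ψ₁,ψ₂⟩_W = Σ m_γ ψ̂₁(γ) conj ψ̂₂(γ̄)` | (1.2) `= W(ψ₁ ∗ ψ̃₂) = Σ m_γ ψ̂₁(−γ)ψ̂₂♯(−γ)` (TeX l.135–150) | `HasWeilHermitianForm`, `hasWeilHermitianForm_weilFunctional` — PROVED (= COLUMN 2's `weilFunctional`) |
| Thm. 1.2 (1) `𝓗(E_ξ) = E_ξ𝖥(V(0))` | Lemma 5.1 (TeX l.1464) | `Suzuki2025_lemma51` — RH-CONSEQUENCE |
| §3 `V(0) ≅ L²(τ)` | Lemma 5.3 (TeX l.1545), (5.5) | `Suzuki2025_lemma53` — RH-CONSEQUENCE |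
| Thm. 1.1 / Thm. 1.2 (2) norm identity | Thm. 1.1 (TeX l.227) / Thm. 5.5 (1) (TeX l.1676), (5.10) | `Suzuki2025_thm55_normIdentity` — RH-CONSEQUENCE |
| (3.4)–(3.6) basis `ψ_γ` of `V(0)` | Prop. 4.1 (TeX l.1120), (3.5), (4.2), (5.11) | `Suzuki2025_orthogonalBasis` — RH-CONSEQUENCE |
| Thm. 1.2 (4) de Branges subspaces `E_ξ𝖥(V(t))` | Thm. 5.7 (TeX l.1844), axioms (dB1)–(dB3) | `Suzuki2025_thm57` over `suzukiChainSpace` — RH-CONSEQUENCE |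
| Thm. 1.3 `RH ⟺ (1) ∧ (2)` (the cell's RESIDUAL `IsolatedV0`) | Prop. 5.8 (TeX l.1953; arguments printed `−γ, −γ′`) | `Suzuki2025_prop58` — RH-EQUIVALENT·PRINTED; `⟹` = `Suzuki2025_prop58_mp_of` over the two facts above, `⟸` = the Summits door |
| Thm. 3.1 (`∃` a subspace `V` with (1) ∧ (2)) | COMMENTED OUT in the v3 TeX (l.2004–2031): NOT in the version of record | not declared (the `Defs` predicates are parametrised by `V` anyway) |
| p. 3 L41–44 "prove or disprove `V(0) ≠ {0}` unconditionally … future task" | Remark 5.2 (TeX l.1500) + "we expect `V(t) ≠ 0` …" (l.1943) | OPEN IN PRINT, never a fact; RH-free reduction `suzukiK_add_suzukiK_self`/`suzukiK_sub_suzukiK_self`; `RH ⟹ V(0) ≠ {0}` = `suzukiV_zero_ne_singleton_of_basis` |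
| §4 Hilbert–Pólya `(𝓗_W, 𝖠_{W,π/2})` | §6 (TeX l.2033–2105), prose under RH, no numbered statement | docstring record only (see "Not typed") |
| §5 quotient `L_W/L_W° ≅ V(0) ≅ 𝓗_W` (Connes analogy) | dropped from the version of record | not typed |

The `−γ` of the version of record versus the `γ` of v1 (and of the `Defs` predicates) is the
reflection `ρ ↦ 1 − ρ` of the non-trivial zeros (`γ(1 − ρ) = −γ(ρ)`, multiplicities preserved):
the cell's `zeroSeparationOn_iff_neg` / `weilNormIdentityOn_iff_neg`
(`SuzukiWeilHatValueProofs.lean`) prove in the kernel that the two printed forms of conditions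
(1), (2) are the same predicates; they are used, not restated, here.

## Not typed (and why)

* The completion `𝓗_W` of `(C_c^∞, ⟨·,·⟩_W)`, the model space `𝓚(Θ_ξ) = H² ⊖ Θ_ξH²` and the
  unconditional spaces `𝓗₀`, `𝓚₀` of CJM §3.3: `𝓗_W`, `𝓚(Θ_ξ)` exist only under RH (CJM p. 3:
  "it is not even possible to define `𝓗_W`, `𝓗(E_ξ)`, and `𝓚(Θ_ξ)` without assuming the RH"),
  and the tree has no Hardy-space/model-space vocabulary (cell GAP note F8). Hence Thm. 1.1's
  ISOMORPHISM clause `𝓚(Θ_ξ) ≅ 𝓗_W`, Lemma 5.4 (`𝓗_W ≅ L²(τ)`), Thm. 5.5 (2), Thm. 5.6 and the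
  first clause `𝓚(Θ) = 𝖥(V(0))` of Lemma 5.1 are represented by their content on the
  representatives `V(0)`: the norm identity (`Suzuki2025_thm55_normIdentity`) and the
  isomorphism `V(0) ≅ L²(τ)` (`Suzuki2025_lemma53`); the statement "every class of `𝓗_W` has a
  unique representative in `V(0)`" needs `𝓗_W` as a type and is recorded here only.
* CJM §6 (Hilbert–Pólya, under RH): `𝖠 := 𝖥⁻¹𝖬𝖥` on `V(0)` and the self-adjoint extension
  `𝖠_{W,π/2}` whose eigenvectors are the `[ψ_γ]` with eigenvalues `γ ∈ Γ`, "the multiplicity of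
  `γ` as an eigenvalue is one" (so NOT an `IsHilbertPolyaOperator` of
  `Literature/Analysis/UnboundedOperators/HilbertPolya.lean`, which counts multiplicity) — prose,
  no numbered statement; its typed shadow is the orthogonal basis `Suzuki2025_orthogonalBasis`.
* CJM Thm. 1.4 / Cor. 1.5 / Thm. 4.5 (the one-condition criteria on `C_c^∞` and on `V°(0)`),
  Props. 1.2–1.3, 3.1, 4.1 (as a statement about `𝓚(Θ)`), Thm. 4.2, Cor. 4.3, Thm. 4.4, Thm. 7.1
  and the LI bridge Cor. 4.6 ("the RH holds if (4.11) holds for all `g_n`", Bombieri–Lagarias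
  test functions) belong to the screw-line module of the preprint arXiv:2209.04658 (cell row t7).
  (Cor. 1.5 itself — the space `V°(0) ⊂ L²(ℝ)` and the reading of `⟨ψ,ψ⟩_W` on it — is typed in §F
  below over that module's `P̂_φ`, `D`, together with the Plancherel constant (5.8) and the last
  clause of Thm. 5.6, "`V(0)` is the `L²`-closure of `V°(0)`".)
* "`E_ξ` belongs to the Hermite–Biehler class under the RH [La06, Thm. 1]" is typed by the cell's
  `LagariasXiStructureFunction.lean`; it is never asserted unconditionally.
-/

noncomputable section

open MeasureTheory Complex Filter Set
open scoped ComplexConjugate FourierTransform Topology ENNReal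

namespace Literature.NumberTheory.LFunctions

open Literature.Analysis.DeBrangesSpaces

/-! ## A. `E_ξ(0) ≠ 0` and `|Θ̃| = 1` almost everywhere (RH-FREE, proved)

The real zeros of `E_ξ` (the MULTIPLE critical zeros of `ξ`; CJM §3.2: "zeros of `E(z)` in the
denominator cancel out in the numerator `E♯(z)`, even if they exist") form a Lebesgue-null set. The
undilated statement `∀ᵐ x, E_ξ(x) ≠ 0` is the cell's `ae_lagariasE_ofReal_ne_zero`
(`LagariasXiStructureFunctionProofs.lean`); here we need it in the Fourier variable `u = −2πξ` of the
`Defs` convention bookkeeping, proved directly by the same discreteness argument (kept import-light). -/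

/-- `ξ′(1/2) = 0`, from the functional equation `ξ(1 − s) = ξ(s)` (`riemannXi_one_sub`); local copy
of `ZetaScrewGrowth.deriv_riemannXi_one_half` (`ZetaScrewGrowthMomentsProofs.lean`, not imported to
keep this module's dependency cone inside the Suzuki/Weil files).
[cite: Titchmarsh1986, §2.1 (functional equation (2.1.13))] -/
private theorem deriv_riemannXi_one_half_aux : deriv riemannXi (1 / 2) = 0 := by
  have h : deriv (fun s ↦ riemannXi (1 - s)) (1 / 2 : ℂ) = -deriv riemannXi (1 - 1 / 2) :=
    deriv_comp_const_sub riemannXi 1 (1 / 2)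
  have hfe : (fun s ↦ riemannXi (1 - s)) = riemannXi := funext riemannXi_one_sub
  rw [hfe] at h
  norm_num at h
  linear_combination (1 / 2 : ℂ) * h

/-- `E_ξ(0) = ξ(1/2)` (since `ξ′(1/2) = 0`). [cite: Suzuki2025WeilHilbertSpace, CJM eq. (1.3) p. 2 (= arXiv v1 eq. (1.2))] -/
theorem lagariasE_zero : lagariasE 0 = riemannXi (1 / 2) := by
  simp only [lagariasE, mul_zero, sub_zero, deriv_riemannXi_one_half_aux, add_zero]

/-- `ξ(1/2) ≠ 0` (local copy of the tree's `riemannXi_one_half_ne_zero` of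
`RiemannXiHadamardProduct.lean`, reproved from `riemannXi_eq_zero_iff_holds` and
`im_ne_zero_of_riemannZeta_eq_zero` to keep imports light). [cite: Titchmarsh1986, §2.12] -/
private theorem xi_one_half_ne_zero_aux : riemannXi (1 / 2) ≠ 0 := by
  intro h
  obtain ⟨hζ, h0, h1⟩ := (riemannXi_eq_zero_iff_holds (1 / 2)).1 h
  exact im_ne_zero_of_riemannZeta_eq_zero hζ h0 h1 (by simp)

/-- `E_ξ(0) ≠ 0`; in particular `E_ξ` is not identically zero. RH-FREE.
[cite: Suzuki2025WeilHilbertSpace, CJM eq. (1.3) p. 2 ("the entire function E_ξ")] -/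
theorem lagariasE_zero_ne_zero : lagariasE 0 ≠ 0 := by
  rw [lagariasE_zero]; exact xi_one_half_ne_zero_aux

/-- In the Fourier variable: `E_ξ(−2πξ) ≠ 0` for almost every `ξ ∈ ℝ`. Proof: `ξ ↦ E_ξ(−2πξ)` is
real-analytic and `≠ 0` at `ξ = 0` (`lagariasE_zero_ne_zero`), so its zero set is discrete
(`AnalyticOnNhd.preimage_zero_mem_codiscrete`), hence Lebesgue-null
(`ae_restrict_le_codiscreteWithin`); compare the cell's `ae_lagariasE_ofReal_ne_zero`. RH-FREE.
[cite: Suzuki2025WeilHilbertSpace, CJM §3.2 p. 8 ("|Θ(z)| = 1 for every z ∈ ℝ … zeros of E(z) … cancel out")] -/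
theorem lagariasE_dilate_ne_zero_ae :
    ∀ᵐ ξ : ℝ, lagariasE ((-2 * Real.pi * ξ : ℝ) : ℂ) ≠ 0 := by
  set g : ℝ → ℂ := fun ξ ↦ lagariasE ((-2 * Real.pi * ξ : ℝ) : ℂ) with hg_def
  have hlin : AnalyticOnNhd ℝ (fun ξ : ℝ ↦ ((-2 * Real.pi * ξ : ℝ) : ℂ)) univ := by
    intro ξ _
    have h1 : AnalyticAt ℝ (fun ξ : ℝ ↦ -2 * Real.pi * ξ) ξ := analyticAt_const.mul analyticAt_id
    exact (Complex.ofRealCLM.analyticAt _).comp h1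
  have hg : AnalyticOnNhd ℝ g univ := fun ξ _ ↦
    ((differentiable_lagariasE.analyticAt _).restrictScalars (𝕜 := ℝ)).comp (hlin ξ trivial)
  have h0 : g 0 ≠ 0 := by simpa [hg_def] using lagariasE_zero_ne_zero
  have hcod : g ⁻¹' {0}ᶜ ∈ Filter.codiscrete ℝ := hg.preimage_zero_mem_codiscrete h0
  have hle : ae (volume : Measure ℝ) ≤ Filter.codiscrete ℝ := by
    have := ae_restrict_le_codiscreteWithin (μ := (volume : Measure ℝ)) MeasurableSet.univ
    rwa [Measure.restrict_univ] at this
  exact hle hcod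

/-- `|Θ̃(ξ)| = |Θ_ξ(−2πξ)| = 1` for almost every `ξ ∈ ℝ` ("`𝖬_Θ` … isometries on `L²(ℝ)`";
CJM §3.2: "`|Θ(z)| = 1` for every `z ∈ ℝ`", understood off the null set of multiple critical
zeros, where the tree's `lagariasTheta` has the junk value `0`). RH-FREE.
[cite: Suzuki2025WeilHilbertSpace, CJM §5 p. 13 (TeX l.1436–1441) (= arXiv v1 p. 2 L145–147)] -/
theorem norm_suzukiMultiplier_eq_one_ae : ∀ᵐ ξ : ℝ, ‖suzukiMultiplier ξ‖ = 1 := by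
  filter_upwards [lagariasE_dilate_ne_zero_ae] with ξ hξ
  exact norm_lagariasTheta_ofReal hξ

/-! ## B. `𝖪` is an isometric involution; the chain `V(t)` (CJM §5 (5.1)–(5.2); RH-FREE, proved)

CJM p. 13 (TeX l.1436–1444): "the multiplication operator `𝖬_Θ`, and the involution `𝖩` are …
isometries on `L²(ℝ)`. The Fourier transform `𝖥` is an isometry up to a constant factor.
Therefore, `𝖪` is isometric on `L²(ℝ)`. Further, `𝖪` is invertible by `𝖪² = id`. … The set of
subspaces `V(t)` of `L²(ℝ)` are clearly totally ordered by the set-theoretical inclusion."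
CJM §5.1 p. 17 (TeX l.1947): "the space `V(0)` can be constructed unconditionally". -/

/-- `𝖬_{Θ̃}` is an isometry of `L²(ℝ)` (`|Θ̃| = 1` a.e.). RH-FREE.
[cite: Suzuki2025WeilHilbertSpace, CJM §5 p. 13 (TeX l.1436–1440) (= arXiv v1 p. 2 L145–147)] -/
theorem norm_suzukiM (f : Lp ℂ 2 (volume : Measure ℝ)) : ‖suzukiM f‖ = ‖f‖ := by
  rw [Lp.norm_def, Lp.norm_def]
  congr 1
  apply eLpNorm_congr_norm_ae
  filter_upwards [coeFn_suzukiM f, norm_suzukiMultiplier_eq_one_ae] with ξ h1 h2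
  rw [h1, norm_mul, h2, one_mul]

/-- `𝖩` (pointwise conjugation) is an isometry of `L²(ℝ)`. RH-FREE.
[cite: Suzuki2025WeilHilbertSpace, CJM §5 p. 13 (TeX l.1436–1440) (= arXiv v1 p. 2 L145–147)] -/
theorem norm_suzukiJ (f : Lp ℂ 2 (volume : Measure ℝ)) : ‖suzukiJ f‖ = ‖f‖ := by
  rw [Lp.norm_def, Lp.norm_def]
  congr 1
  apply eLpNorm_congr_norm_ae
  filter_upwards [coeFn_suzukiJ f] with ξ h1
  rw [h1, Complex.norm_conj]

/-- Plancherel for the inverse `L²` Fourier transform of Mathlib (`‖𝓕⁻g‖ = ‖g‖`; in Mathlib's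
normalisation `𝖥` is an honest isometry, Suzuki's "up to a constant factor" is absorbed in the
convention bookkeeping of the `Defs` module). [folklore] -/
private theorem norm_fourierInv_Lp (g : Lp ℂ 2 (volume : Measure ℝ)) :
    ‖(𝓕⁻ g : Lp ℂ 2 (volume : Measure ℝ))‖ = ‖g‖ := by
  rw [← Lp.norm_fourier_eq (𝓕⁻ g : Lp ℂ 2 (volume : Measure ℝ)),
    FourierTransform.fourier_fourierInv_eq]

/-- **`𝖪` is isometric on `L²(ℝ)`** (node Su25c:K-isometry, DISCHARGED): `‖𝖪f‖ = ‖f‖`. RH-FREE.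
[cite: Suzuki2025WeilHilbertSpace, CJM §5 p. 13 (TeX l.1441: "Therefore, 𝖪 is isometric on L²(ℝ)") (= arXiv v1 p. 2 L147)] -/
theorem norm_suzukiK (f : Lp ℂ 2 (volume : Measure ℝ)) : ‖suzukiK f‖ = ‖f‖ := by
  unfold suzukiK
  rw [norm_fourierInv_Lp, norm_suzukiM, norm_suzukiJ, Lp.norm_fourier_eq]

/-- `𝖬_{Θ̃}𝖩𝖬_{Θ̃}𝖩 = id` on `L²(ℝ)`: `Θ̃ · conj(Θ̃ · conj g) = |Θ̃|² g = g` a.e. RH-FREE.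
[cite: Suzuki2025WeilHilbertSpace, CJM §5 p. 13 (TeX l.1442: "𝖪 is invertible by 𝖪² = id")] -/
theorem suzukiM_suzukiJ_suzukiM_suzukiJ (g : Lp ℂ 2 (volume : Measure ℝ)) :
    suzukiM (suzukiJ (suzukiM (suzukiJ g))) = g := by
  ext1
  filter_upwards [coeFn_suzukiM (suzukiJ (suzukiM (suzukiJ g))),
    coeFn_suzukiJ (suzukiM (suzukiJ g)), coeFn_suzukiM (suzukiJ g), coeFn_suzukiJ g,
    norm_suzukiMultiplier_eq_one_ae] with ξ h1 h2 h3 h4 h5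
  rw [h1, h2, h3, h4, map_mul, Complex.conj_conj, ← mul_assoc, Complex.mul_conj,
    Complex.normSq_eq_norm_sq, h5]
  simp

/-- **`𝖪² = id`** (node Su25c:K-isometry, second clause, DISCHARGED): `𝖪(𝖪f) = f` for every
`f ∈ L²(ℝ)`, from `𝓕𝓕⁻ = id`, `𝓕⁻𝓕 = id` and `suzukiM_suzukiJ_suzukiM_suzukiJ`. RH-FREE.
[cite: Suzuki2025WeilHilbertSpace, CJM §5 p. 13 (TeX l.1442: "Further, 𝖪 is invertible by 𝖪² = id") (= arXiv v1 p. 2 L148)] -/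
theorem suzukiK_suzukiK (f : Lp ℂ 2 (volume : Measure ℝ)) : suzukiK (suzukiK f) = f := by
  unfold suzukiK
  rw [FourierTransform.fourier_fourierInv_eq, suzukiM_suzukiJ_suzukiM_suzukiJ,
    FourierTransform.fourierInv_fourier_eq]

/-- `𝖪` is an involution ("the isometric involution `𝖪`", CJM TeX l.1444).
[cite: Suzuki2025WeilHilbertSpace, CJM §5 p. 13 (TeX l.1444)] -/
theorem suzukiK_involutive : Function.Involutive suzukiK := suzukiK_suzukiK

/-- Images under the involution `𝖪` are preimages: `𝖪(S) = 𝖪⁻¹(S)` (by `𝖪² = id`).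
[cite: Suzuki2025WeilHilbertSpace, CJM §5 p. 13 (TeX l.1442: "𝖪 is invertible by 𝖪² = id")] -/
theorem suzukiK_image_eq_preimage (S : Set (Lp ℂ 2 (volume : Measure ℝ))) :
    suzukiK '' S = suzukiK ⁻¹' S :=
  congrFun suzukiK_involutive.image_eq_preimage_symm S

/-- `𝖪0 = 0` (`𝖪` is additive). A Summits-side copy exists
(`Theorems/DeBrangesChainDoorWeilSign.lean`, which Literature cannot import); this is the Literature
home of the lemma. [cite: Suzuki2025WeilHilbertSpace, CJM §5 p. 13 (TeX l.1443: "𝖪 is … ℝ-linear")] -/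
theorem suzukiK_zero : suzukiK (0 : Lp ℂ 2 (volume : Measure ℝ)) = 0 := by
  have h := suzukiK_sub (0 : Lp ℂ 2 (volume : Measure ℝ)) 0
  rwa [sub_zero, sub_self] at h

/-- `𝖪` is an isometry of the metric space `L²(ℝ)` (additive and norm-preserving). RH-FREE.
[cite: Suzuki2025WeilHilbertSpace, CJM §5 p. 13 (TeX l.1441–1444)] -/
theorem isometry_suzukiK : Isometry suzukiK :=
  Isometry.of_dist_eq fun f g ↦ by rw [dist_eq_norm, dist_eq_norm, ← suzukiK_sub, norm_suzukiK]

/-- `𝖪` is continuous on `L²(ℝ)`. [cite: Suzuki2025WeilHilbertSpace, CJM §5 p. 13 (TeX l.1441–1444)] -/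
theorem continuous_suzukiK : Continuous suzukiK := isometry_suzukiK.continuous

/-- The working form of `V(t)`: `f ∈ V(t) ⟺ f ∈ L²(t,∞) ∧ 𝖪f ∈ L²(t,∞)` (equivalent to the
printed `L²(t,∞) ∩ 𝖪L²(t,∞)` BECAUSE `𝖪² = id`; the `Defs` module typed the printed image form).
[cite: Suzuki2025WeilHilbertSpace, CJM eq. (5.2) p. 13 (= arXiv v1 p. 2 L150)] -/
theorem mem_suzukiV_iff {t : ℝ} {f : Lp ℂ 2 (volume : Measure ℝ)} :
    f ∈ suzukiV t ↔ f ∈ halfLineL2 t ∧ suzukiK f ∈ halfLineL2 t := by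
  rw [suzukiV, suzukiK_image_eq_preimage]; rfl

/-- `f ∈ L²(t,∞)` iff `f = 0` a.e. for Lebesgue measure restricted to `(−∞,t)`.
[cite: Suzuki2025WeilHilbertSpace, CJM eq. (5.2) p. 13 (the subspace L²(t,∞) of L²(ℝ))] -/
theorem mem_halfLineL2_iff_restrict {t : ℝ} {f : Lp ℂ 2 (volume : Measure ℝ)} :
    f ∈ halfLineL2 t ↔ (f : ℝ → ℂ) =ᵐ[volume.restrict (Iio t)] 0 := by
  rw [halfLineL2, mem_setOf_eq, EventuallyEq, ae_restrict_iff' measurableSet_Iio]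
  simp only [mem_Iio, Pi.zero_apply]

/-- `L²(t,∞)` is the kernel of the (continuous linear) restriction map
`L²(ℝ) → L²((−∞,t))` (`MeasureTheory.LpToLpRestrictCLM`).
[cite: Suzuki2025WeilHilbertSpace, CJM eq. (5.2) p. 13 (the subspace L²(t,∞) of L²(ℝ))] -/
theorem halfLineL2_eq_preimage (t : ℝ) :
    halfLineL2 t = (LpToLpRestrictCLM ℝ ℂ ℂ (volume : Measure ℝ) 2 (Iio t)) ⁻¹' {0} := by
  ext f
  rw [mem_preimage, mem_singleton_iff, mem_halfLineL2_iff_restrict, Lp.eq_zero_iff_ae_eq_zero]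
  exact ⟨fun h ↦ (LpToLpRestrictCLM_coeFn ℂ (Iio t) f).trans h,
    fun h ↦ (LpToLpRestrictCLM_coeFn ℂ (Iio t) f).symm.trans h⟩

/-- `L²(t,∞)` is a closed subset of `L²(ℝ)`. RH-FREE.
[cite: Suzuki2025WeilHilbertSpace, CJM eq. (5.2) p. 13 ("subspaces V(t) of L²(ℝ)")] -/
theorem isClosed_halfLineL2 (t : ℝ) : IsClosed (halfLineL2 t) := by
  rw [halfLineL2_eq_preimage]
  exact isClosed_singleton.preimage (LpToLpRestrictCLM ℝ ℂ ℂ volume 2 (Iio t)).continuous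

/-- **`V(t)` is closed in `L²(ℝ)`** (node Su25c:V0-closed, DISCHARGED): intersection of the closed
`L²(t,∞)` with its preimage under the continuous `𝖪`. So `V(t)` is a Hilbert space with the `L²`
inner product ("Hilbert spaces `V(0)` and `L²(τ)`", CJM Lemma 5.3). RH-FREE.
[cite: Suzuki2025WeilHilbertSpace, CJM eq. (5.2) p. 13 and Lemma 5.3 p. 14 (= arXiv v1 p. 2–3)] -/
theorem isClosed_suzukiV (t : ℝ) : IsClosed (suzukiV t) := by
  rw [suzukiV, suzukiK_image_eq_preimage]
  exact (isClosed_halfLineL2 t).inter ((isClosed_halfLineL2 t).preimage continuous_suzukiK)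

/-- `t ↦ L²(t,∞)` is decreasing (the source of the total order of the `V(t)`).
[cite: Suzuki2025WeilHilbertSpace, CJM §5 p. 13 (TeX l.1451: "totally ordered by the set-theoretical inclusion")] -/
theorem halfLineL2_antitone : Antitone halfLineL2 := fun s t hst f hf ↦ by
  simp only [halfLineL2, mem_setOf_eq] at hf ⊢
  filter_upwards [hf] with x hx hxs
  exact hx (hxs.trans_le hst)

/-- **The chain**: `t ↦ V(t)` is decreasing, so the `V(t)` are totally ordered by inclusion
("clearly totally ordered by the set-theoretical inclusion"). RH-FREE.
[cite: Suzuki2025WeilHilbertSpace, CJM §5 p. 13 (TeX l.1451) (= arXiv v1 p. 3 L2)] -/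
theorem suzukiV_antitone : Antitone suzukiV := fun _ _ hst ↦
  inter_subset_inter (halfLineL2_antitone hst) (image_mono (halfLineL2_antitone hst))

/-- `V(t)` is `𝖪`-invariant ("Since `V(0)` is `𝖪`-invariant", Remark 5.2; by `𝖪² = id`). RH-FREE.
[cite: Suzuki2025WeilHilbertSpace, CJM Remark 5.2 p. 14 (TeX l.1500–1510)] -/
theorem suzukiK_mem_suzukiV {t : ℝ} {f : Lp ℂ 2 (volume : Measure ℝ)} (hf : f ∈ suzukiV t) :
    suzukiK f ∈ suzukiV t := by
  rw [mem_suzukiV_iff] at hf ⊢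
  rw [suzukiK_suzukiK]
  exact hf.symm

/-- `0 ∈ L²(t,∞)`. [cite: Suzuki2025WeilHilbertSpace, CJM eq. (5.2) p. 13 (the subspace L²(t,∞) of L²(ℝ))] -/
theorem zero_mem_halfLineL2 (t : ℝ) : (0 : Lp ℂ 2 (volume : Measure ℝ)) ∈ halfLineL2 t := by
  simp only [halfLineL2, mem_setOf_eq]
  filter_upwards [Lp.coeFn_zero ℂ 2 (volume : Measure ℝ)] with x hx _
  exact hx

/-- `L²(t,∞)` is closed under addition. [cite: Suzuki2025WeilHilbertSpace, CJM eq. (5.2) p. 13 (the subspace L²(t,∞) of L²(ℝ))] -/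
theorem add_mem_halfLineL2 {t : ℝ} {f g : Lp ℂ 2 (volume : Measure ℝ)} (hf : f ∈ halfLineL2 t)
    (hg : g ∈ halfLineL2 t) : f + g ∈ halfLineL2 t := by
  simp only [halfLineL2, mem_setOf_eq] at hf hg ⊢
  filter_upwards [hf, hg, Lp.coeFn_add f g] with x h1 h2 h3
  intro hx
  rw [h3, Pi.add_apply, h1 hx, h2 hx, add_zero]

/-- `L²(t,∞)` is closed under complex scalars. [cite: Suzuki2025WeilHilbertSpace, CJM eq. (5.2) p. 13 (the subspace L²(t,∞) of L²(ℝ))] -/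
theorem smul_mem_halfLineL2 {t : ℝ} (c : ℂ) {f : Lp ℂ 2 (volume : Measure ℝ)}
    (hf : f ∈ halfLineL2 t) : c • f ∈ halfLineL2 t := by
  simp only [halfLineL2, mem_setOf_eq] at hf ⊢
  filter_upwards [hf, Lp.coeFn_smul c f] with x h1 h2
  intro hx
  rw [h2, Pi.smul_apply, h1 hx, smul_zero]

/-- **`V(t)` is a `ℂ`-linear subspace of `L²(ℝ)`** (although `𝖪` is only conjugate-linear:
`c • 𝖪φ = 𝖪(c̄ • φ)`), bundled as a `Submodule` with carrier `suzukiV t`; with `isClosed_suzukiV`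
it is a Hilbert space for the `L²` inner product (the "Hilbert space `V(0)`" of Lemma 5.3). RH-FREE.
[cite: Suzuki2025WeilHilbertSpace, CJM eq. (5.2) p. 13 and Lemma 5.3 p. 14 ("Hilbert spaces V(0) and L²(τ)")] -/
def suzukiVSubmodule (t : ℝ) : Submodule ℂ (Lp ℂ 2 (volume : Measure ℝ)) where
  carrier := suzukiV t
  zero_mem' := ⟨zero_mem_halfLineL2 t, 0, zero_mem_halfLineL2 t, suzukiK_zero⟩
  add_mem' := by
    rintro f g ⟨hf, φ, hφ, rfl⟩ ⟨hg, χ, hχ, rfl⟩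
    exact ⟨add_mem_halfLineL2 hf hg, φ + χ, add_mem_halfLineL2 hφ hχ, suzukiK_add φ χ⟩
  smul_mem' := by
    rintro c f ⟨hf, φ, hφ, rfl⟩
    refine ⟨smul_mem_halfLineL2 c hf, conj c • φ, smul_mem_halfLineL2 _ hφ, ?_⟩
    rw [suzukiK_smul, Complex.conj_conj]

/-- Membership in the bundled `V(t)` is membership in `suzukiV t`. [cite: Suzuki2025WeilHilbertSpace, CJM eq. (5.2) p. 13] -/
@[simp] theorem mem_suzukiVSubmodule {t : ℝ} {f : Lp ℂ 2 (volume : Measure ℝ)} :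
    f ∈ suzukiVSubmodule t ↔ f ∈ suzukiV t := Iff.rfl

/-- The bundled `V(t)` is closed. [cite: Suzuki2025WeilHilbertSpace, CJM eq. (5.2) p. 13] -/
theorem isClosed_suzukiVSubmodule (t : ℝ) :
    IsClosed (suzukiVSubmodule t : Set (Lp ℂ 2 (volume : Measure ℝ))) :=
  isClosed_suzukiV t

/-- `V(t)` is complete, i.e. a Hilbert space with the inner product of `L²(ℝ)`. RH-FREE.
[cite: Suzuki2025WeilHilbertSpace, CJM Lemma 5.3 p. 14 ("Hilbert spaces V(0) and L²(τ)")] -/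
theorem completeSpace_suzukiVSubmodule (t : ℝ) : CompleteSpace (suzukiVSubmodule t) :=
  (isClosed_suzukiV t).completeSpace_coe

/-- Remark 5.2, RH-free part: `f + 𝖪f` is fixed by `𝖪` (eigenvalue `+1`).
[cite: Suzuki2025WeilHilbertSpace, CJM Remark 5.2 p. 14 ("(1 ± 𝖪)f are eigenfunctions of 𝖪 with eigenvalues ±1")] -/
theorem suzukiK_add_suzukiK_self (f : Lp ℂ 2 (volume : Measure ℝ)) :
    suzukiK (f + suzukiK f) = f + suzukiK f := by
  rw [suzukiK_add, suzukiK_suzukiK, add_comm]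

/-- Remark 5.2, RH-free part: `f − 𝖪f` is an eigenvector of `𝖪` for `−1`. Suzuki: "the problem
[`V(0) ≠ {0}` unconditionally] reduces to determining whether the isometric involution `𝖪` admits an
eigenfunction in `L²(0,∞)`, which appears to be extremely difficult" — OPEN IN PRINT, not a fact.
[cite: Suzuki2025WeilHilbertSpace, CJM Remark 5.2 p. 14 ("(1 ± 𝖪)f are eigenfunctions of 𝖪 with eigenvalues ±1")] -/
theorem suzukiK_sub_suzukiK_self (f : Lp ℂ 2 (volume : Measure ℝ)) :
    suzukiK (f - suzukiK f) = -(f - suzukiK f) := by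
  rw [suzukiK_sub, suzukiK_suzukiK, neg_sub]

/-! ## C. The evaluation `HasHatValue` is linear (RH-FREE, proved)

Single-valuedness (`HasHatValue.unique`) and agreement with the printed integral at real points for
integrable `ψ` (`hasHatValue_ofReal_of_integrableOn`) are the cell's
`Literature/NumberTheory/LFunctions/SuzukiWeilHatValueProofs.lean`; additivity is the `Defs` module's
`hasHatValue_sub`. -/

/-- The half-line transform is homogeneous: `(aψ)^(z) = a ψ̂(z)` on `(0,∞)` (linearity of `𝖥`).
[cite: Suzuki2025WeilHilbertSpace, CJM eq. (1.1) p. 2 (the Fourier transform 𝖥)] -/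
theorem upperHalfHat_smul (a : ℂ) (f : Lp ℂ 2 (volume : Measure ℝ)) (z : ℂ) :
    upperHalfHat (↑(a • f)) z = a * upperHalfHat f z := by
  unfold upperHalfHat
  rw [← integral_const_mul]
  refine integral_congr_ae ?_
  filter_upwards [ae_restrict_of_ae (Lp.coeFn_smul a f)] with x hx
  rw [hx, Pi.smul_apply, smul_eq_mul, mul_assoc]

/-- **Homogeneity of the evaluation**: if `c` is the value `ψ̂(γ)` then `a c` is the value
`(aψ)^(γ)` (all three clauses; in the lower half-plane through the conjugate-linearity of `𝖪`).
With `hasHatValue_sub` this makes `ψ ↦ ψ̂(γ)` `ℂ`-linear on `L²(ℝ)`, as used for the linear map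
`ψ ↦ S_ψ = (ψ̂(γ))_γ` of Lemma 5.3. RH-FREE. [cite: Suzuki2025WeilHilbertSpace, CJM Lemma 5.3 p. 14 ("the linear map V(0) ∋ ψ ↦ S_ψ")] -/
theorem hasHatValue_smul (a : ℂ) {ψ : Lp ℂ 2 (volume : Measure ℝ)} {γ c : ℂ}
    (h : HasHatValue ψ γ c) : HasHatValue (a • ψ) γ (a * c) := by
  rcases h with ⟨hγ, rfl⟩ | ⟨hγ, rfl⟩ | ⟨hγ, h⟩
  · exact Or.inl ⟨hγ, (upperHalfHat_smul a ψ γ).symm⟩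
  · refine Or.inr (Or.inl ⟨hγ, ?_⟩)
    rw [suzukiK_smul, upperHalfHat_smul, map_mul, Complex.conj_conj]
    ring
  · refine Or.inr (Or.inr ⟨hγ, ?_⟩)
    have heq : (fun y : ℝ ↦ upperHalfHat (↑(a • ψ)) (γ + I * y)) =
        fun y : ℝ ↦ a * upperHalfHat ψ (γ + I * y) := funext fun y ↦ upperHalfHat_smul a ψ _
    rw [heq]
    exact h.const_mul a

/-- The half-line transform of the zero class vanishes (linearity of `𝖥`). (Summits-side copy:
`DeBrangesChain.upperHalfHat_zero` in `Theorems/DeBrangesChainDoorWeilSign.lean`, not importable here.)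
[cite: Suzuki2025WeilHilbertSpace, CJM eq. (1.1) p. 2 (the Fourier transform 𝖥)] -/
theorem upperHalfHat_coeFn_zero (z : ℂ) :
    upperHalfHat ((0 : Lp ℂ 2 (volume : Measure ℝ)) : ℝ → ℂ) z = 0 := by
  unfold upperHalfHat
  have h : (fun x : ℝ ↦ ((0 : Lp ℂ 2 (volume : Measure ℝ)) : ℝ → ℂ) x * cexp (I * z * x))
      =ᵐ[volume.restrict (Ioi 0)] fun _ ↦ 0 := by
    filter_upwards [ae_restrict_of_ae (Lp.coeFn_zero ℂ 2 (volume : Measure ℝ))] with x hx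
    rw [hx, Pi.zero_apply, zero_mul]
  rw [integral_congr_ae h, integral_zero]

/-- The zero function has only the value `0` at every `γ` (all three clauses; linearity of
`ψ ↦ S_ψ = (ψ̂(γ))_γ`). (Summits-side copy: `DeBrangesChain.eq_zero_of_hasHatValue_zero` in
`Theorems/DeBrangesChainDoorWeilSign.lean`, not importable into Literature.)
[cite: Suzuki2025WeilHilbertSpace, CJM Lemma 5.3 p. 14 ("the linear map V(0) ∋ ψ ↦ S_ψ")] -/
theorem HasHatValue.eq_zero_of_zero {γ c : ℂ}
    (h : HasHatValue (0 : Lp ℂ 2 (volume : Measure ℝ)) γ c) : c = 0 := by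
  rcases h with ⟨-, rfl⟩ | ⟨-, rfl⟩ | ⟨-, h⟩
  · exact upperHalfHat_coeFn_zero γ
  · rw [suzukiK_zero, upperHalfHat_coeFn_zero, map_zero, mul_zero]
  · have heq : (fun y : ℝ ↦ upperHalfHat ((0 : Lp ℂ 2 (volume : Measure ℝ)) : ℝ → ℂ) (γ + I * y))
        = fun _ ↦ 0 := funext fun y ↦ upperHalfHat_coeFn_zero _
    rw [heq] at h
    exact tendsto_nhds_unique h tendsto_const_nhds

/-! ## D. The Weil hermitian form (CJM (1.1)–(1.2)) is COLUMN 2's Weil functional (RH-FREE, proved)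

CJM p. 2 (TeX l.111–150): `W(ψ) := Σ_{γ∈Γ} m_γ ψ̂(−γ)` on `C_c^∞(ℝ)` with
`ψ̂(z) := ∫ ψ(x)e^{izx}dx` (1.1); `⟨ψ₁,ψ₂⟩_W := W(ψ₁ ∗ ψ̃₂) = Σ_γ m_γ ψ̂₁(−γ)(ψ̂₂)♯(−γ)` (1.2),
`ψ̃(x) := conj ψ(−x)`, `F♯(z) := conj F(z̄)`. In the tree (`WeilExplicit.lean`, COLUMN 2):
`weilMellin g ρ = ∫ g(t)e^{(ρ−1/2)t}dt = ĝ(−γ(ρ))` EXACTLY (`suzukiHat_neg_suzukiZeroParam`),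
`weilReflect = ψ̃`, `weilConv = ∗`, and the explicit formula `explicit_formula_holds` gives the zero
sum as the symmetric limit over `|Im ρ| ≤ T`. -/

/-- Suzuki's whole-line Fourier transform `ψ̂(z) = (𝖥ψ)(z) := ∫_{−∞}^{∞} ψ(x)e^{izx}dx` (for
`ψ ∈ C_c^∞(ℝ)` an entire function of `z`; Bochner integral, junk `0` if divergent).
[cite: Suzuki2025WeilHilbertSpace, CJM eq. (1.1) p. 2 (= arXiv v1 p. 2 L27–30)] -/
def suzukiHat (ψ : ℝ → ℂ) (z : ℂ) : ℂ :=
  ∫ x : ℝ, ψ x * cexp (I * z * x)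

/-- DICTIONARY: `ψ̂(−γ(ρ)) = weilMellin ψ ρ` — Suzuki's transform at `−γ` is the tree's
Mellin–Laplace transform of COLUMN 2 at `ρ` (both are `∫ ψ(x)e^{(ρ−1/2)x}dx`). RH-FREE.
[cite: Suzuki2025WeilHilbertSpace, CJM eq. (1.1) p. 2] -/
theorem suzukiHat_neg_suzukiZeroParam (ψ : ℝ → ℂ) (ρ : ℂ) :
    suzukiHat ψ (-suzukiZeroParam ρ) = weilMellin ψ ρ := by
  unfold suzukiHat weilMellin suzukiZeroParam
  congr 1 with x
  congr 2
  have hI : I * I = -1 := Complex.I_mul_I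
  linear_combination (-(ρ - 1 / 2) * (x : ℂ)) * hI

/-- DICTIONARY at the reflected zero: `ψ̂(−γ̄(ρ)) = weilMellin ψ (1 − ρ̄)`. RH-FREE.
[cite: Suzuki2025WeilHilbertSpace, CJM eq. (1.2) p. 2] -/
theorem suzukiHat_neg_conj_suzukiZeroParam (ψ : ℝ → ℂ) (ρ : ℂ) :
    suzukiHat ψ (-conj (suzukiZeroParam ρ)) = weilMellin ψ (1 - conj ρ) := by
  rw [← suzukiZeroParam_one_sub_conj, suzukiHat_neg_suzukiZeroParam]

/-- The `γ`-th term `m_γ ψ̂₁(−γ)(ψ̂₂)♯(−γ) = m_γ ψ̂₁(−γ) conj ψ̂₂(−γ̄)` of the Weil hermitian form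
(1.2), indexed by the zero `ρ` of `ζ` with `γ = γ(ρ)`, `m_γ = riemannZetaZeroOrder ρ`.
[cite: Suzuki2025WeilHilbertSpace, CJM eq. (1.2) p. 2 (= arXiv v1 eq. (1.1))] -/
def weilHermitianTerm (ψ₁ ψ₂ : ℝ → ℂ) (ρ : ℂ) : ℂ :=
  (riemannZetaZeroOrder ρ : ℂ) * (suzukiHat ψ₁ (-suzukiZeroParam ρ) *
    conj (suzukiHat ψ₂ (-conj (suzukiZeroParam ρ))))

/-- **The Weil hermitian form** `⟨ψ₁,ψ₂⟩_W = w` (node Su25c:def-weilFormL2): the sum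
`Σ_{γ∈Γ} m_γ ψ̂₁(−γ)(ψ̂₂)♯(−γ)` over the zeros converges to `w`, the sum over `Γ` being taken as
in Weil's explicit formula (symmetric partial sums over `0 < |Im ρ| ≤ T`, `T → ∞`; the tree's
`weilZeroIndex`). For `ψᵢ ∈ C_c^∞` the series converges absolutely (`summable_norm_weilHermitianTerm`),
so the order is immaterial and the printed sum over `Γ` is an unconditional `HasSum` over the zero
subtype (`hasSum_weilHermitianTerm`). [cite: Suzuki2025WeilHilbertSpace, CJM eq. (1.2) p. 2 (= arXiv v1 eq. (1.1) p. 2)] -/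
def HasWeilHermitianForm (ψ₁ ψ₂ : ℝ → ℂ) (w : ℂ) : Prop :=
  Tendsto (fun T : ℝ ↦ ∑ᶠ ρ ∈ weilZeroIndex T, weilHermitianTerm ψ₁ ψ₂ ρ) atTop (𝓝 w)

/-- Termwise dictionary: for test functions, `m_γ ψ̂₁(−γ)(ψ̂₂)♯(−γ) = m(ρ)·(ψ₁ ∗ ψ̃₂)^(ρ)`
(`weilMellin_weilConv_holds`, `weilMellin_weilReflect_holds`). RH-FREE.
[cite: Suzuki2025WeilHilbertSpace, CJM eq. (1.2) p. 2 ("⟨ψ₁,ψ₂⟩_W = W(ψ₁ ∗ ψ̃₂)")] -/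
theorem weilHermitianTerm_eq_weilMellin {ψ₁ ψ₂ : ℝ → ℂ} (h₁ : IsWeilTest ψ₁) (h₂ : IsWeilTest ψ₂)
    (ρ : ℂ) : weilHermitianTerm ψ₁ ψ₂ ρ =
      (riemannZetaZeroOrder ρ : ℂ) * weilMellin (weilConv ψ₁ (weilReflect ψ₂)) ρ := by
  have h₂' := h₂.weilReflect
  rw [weilHermitianTerm, weilMellin_weilConv_holds h₁.1.continuous h₁.2 h₂'.1.continuous h₂'.2 ρ,
    weilMellin_weilReflect_holds ψ₂ ρ, suzukiHat_neg_suzukiZeroParam,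
    suzukiHat_neg_conj_suzukiZeroParam]

/-- **`⟨ψ₁,ψ₂⟩_W = W(ψ₁ ∗ ψ̃₂)`** — Suzuki's Weil hermitian form on `C_c^∞(ℝ)` IS the Weil
functional of COLUMN 2 (`weilFunctional`) at `ψ₁ ∗ ψ̃₂`, by the Guinand–Weil explicit formula of the
tree (`explicit_formula_holds`). DISCHARGES the definition node: no new Weil object is introduced.
RH-FREE. [cite: Suzuki2025WeilHilbertSpace, CJM eq. (1.2) p. 2 (= arXiv v1 eq. (1.1) p. 2)] -/
theorem hasWeilHermitianForm_weilFunctional {ψ₁ ψ₂ : ℝ → ℂ} (h₁ : IsWeilTest ψ₁)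
    (h₂ : IsWeilTest ψ₂) :
    HasWeilHermitianForm ψ₁ ψ₂ (weilFunctional (weilConv ψ₁ (weilReflect ψ₂))) := by
  have hg : IsWeilTest (weilConv ψ₁ (weilReflect ψ₂)) := h₁.weilConv h₂.weilReflect
  have hef := explicit_formula_holds hg
  unfold HasWeilHermitianForm
  have heq : (fun T : ℝ ↦ ∑ᶠ ρ ∈ weilZeroIndex T, weilHermitianTerm ψ₁ ψ₂ ρ) =
      weilZeroSidePartial (weilConv ψ₁ (weilReflect ψ₂)) := by
    funext T
    unfold weilZeroSidePartial
    exact finsum_mem_congr rfl fun ρ _ ↦ weilHermitianTerm_eq_weilMellin h₁ h₂ ρ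
  rw [heq]
  exact hef

/-- **`⟨ψ,ψ⟩_W = W(ψ ∗ ψ̃) =` COLUMN 2's `weilQuadratic ψ`** for `ψ ∈ C_c^∞(ℝ)`: Weil's criterion
("RH iff `W(ψ ∗ ψ̃) ≥ 0` for every `ψ ∈ C_c^∞`", CJM p. 2, = the tree's `weil_criterion_holds`)
is about exactly this quantity. RH-FREE. [cite: Suzuki2025WeilHilbertSpace, CJM p. 2 (TeX l.120–133, Weil's criterion) and eq. (1.2)] -/
theorem hasWeilHermitianForm_self_weilQuadratic {ψ : ℝ → ℂ} (h : IsWeilTest ψ) :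
    HasWeilHermitianForm ψ ψ (weilQuadratic ψ) :=
  hasWeilHermitianForm_weilFunctional h h

/-- **Absolute convergence and the unconditional sum**: for test functions the Weil hermitian form
is an absolutely convergent sum over the non-trivial zeros, `Σ_ρ m(ρ)ψ̂₁(−γ_ρ)conj ψ̂₂(−γ̄_ρ)
= W(ψ₁ ∗ ψ̃₂)` as a `HasSum` over the zero subtype (decay `|ĝ(ρ)| ≪ (1 + (Im ρ)²)⁻²` in the strip,
`norm_weilMellin_le_sq`, against `Σ m(ρ)/(1 + (Im ρ)²)² < ∞`, `summable_norm_zeroSide_of_le`;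
the value is identified by the explicit formula). So "`Σ_{γ∈Γ}`" in (1.2) needs no ordering. RH-FREE.
[cite: Suzuki2025WeilHilbertSpace, CJM eq. (1.2) p. 2 (= arXiv v1 eq. (1.1) p. 2)] -/
theorem hasSum_weilHermitianTerm {ψ₁ ψ₂ : ℝ → ℂ} (h₁ : IsWeilTest ψ₁) (h₂ : IsWeilTest ψ₂) :
    HasSum (fun ρ : ZetaZeros.riemannZetaNontrivialZeros ↦ weilHermitianTerm ψ₁ ψ₂ ρ)
      (weilFunctional (weilConv ψ₁ (weilReflect ψ₂))) := by
  set g := weilConv ψ₁ (weilReflect ψ₂) with hg_def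
  have hg : IsWeilTest g := h₁.weilConv h₂.weilReflect
  have hbound : ∀ ρ ∈ ZetaZeros.riemannZetaNontrivialZeros,
      ‖weilMellin g ρ‖ ≤ weilDecayW2 (1 / 2) g / (1 + ρ.im ^ 2) ^ 2 := fun ρ hρ ↦
    norm_weilMellin_le_sq hg (by
      have h0 := ZetaZeros.riemannZetaNontrivialZeros.re_pos hρ
      have h1 := ZetaZeros.riemannZetaNontrivialZeros.re_lt_one hρ
      rw [abs_le]; constructor <;> linarith)
  have hsn := summable_norm_zeroSide_of_le hbound
  have htsum := hasWeilZeroSide_tsum hsn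
  have hef : HasWeilZeroSide g (weilFunctional g) := explicit_formula_holds hg
  have heq : (∑' ρ : ZetaZeros.riemannZetaNontrivialZeros,
      (riemannZetaZeroOrder (ρ : ℂ) : ℂ) * weilMellin g ρ) = weilFunctional g :=
    tendsto_nhds_unique htsum hef
  have hfun : (fun ρ : ZetaZeros.riemannZetaNontrivialZeros ↦ weilHermitianTerm ψ₁ ψ₂ ρ) =
      fun ρ : ZetaZeros.riemannZetaNontrivialZeros ↦
        (riemannZetaZeroOrder (ρ : ℂ) : ℂ) * weilMellin g ρ :=
    funext fun ρ ↦ weilHermitianTerm_eq_weilMellin h₁ h₂ ρ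
  rw [hfun, ← heq]
  exact hsn.of_norm.hasSum

/-- The Weil hermitian form of test functions converges absolutely over the non-trivial zeros.
RH-FREE. [cite: Suzuki2025WeilHilbertSpace, CJM eq. (1.2) p. 2 (= arXiv v1 eq. (1.1) p. 2)] -/
theorem summable_norm_weilHermitianTerm {ψ₁ ψ₂ : ℝ → ℂ} (h₁ : IsWeilTest ψ₁)
    (h₂ : IsWeilTest ψ₂) :
    Summable fun ρ : ZetaZeros.riemannZetaNontrivialZeros ↦ ‖weilHermitianTerm ψ₁ ψ₂ ρ‖ := by
  have hg : IsWeilTest (weilConv ψ₁ (weilReflect ψ₂)) := h₁.weilConv h₂.weilReflect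
  have hbound : ∀ ρ ∈ ZetaZeros.riemannZetaNontrivialZeros,
      ‖weilMellin (weilConv ψ₁ (weilReflect ψ₂)) ρ‖ ≤
        weilDecayW2 (1 / 2) (weilConv ψ₁ (weilReflect ψ₂)) / (1 + ρ.im ^ 2) ^ 2 := fun ρ hρ ↦
    norm_weilMellin_le_sq hg (by
      have h0 := ZetaZeros.riemannZetaNontrivialZeros.re_pos hρ
      have h1 := ZetaZeros.riemannZetaNontrivialZeros.re_lt_one hρ
      rw [abs_le]; constructor <;> linarith)
  refine (summable_norm_zeroSide_of_le hbound).congr fun ρ ↦ ?_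
  rw [weilHermitianTerm_eq_weilMellin h₁ h₂]

/-- **Convention dictionary with Mathlib's Fourier transform** (the `Defs` module's bookkeeping,
proved): for real `u`, Suzuki's `ψ̂(u) = ∫ ψ(x)e^{iux}dx` is Mathlib's `(𝓕ψ)(−u/2π)`
(`𝓕ψ(w) = ∫ ψ(x)e^{−2πixw}dx`, `Real.fourier_real_eq_integral_exp_smul`); hence Suzuki's Plancherel
constant `‖ψ̂‖² = 2π‖ψ‖²` (CJM (5.8)) versus Mathlib's `‖𝓕ψ‖ = ‖ψ‖`, and the multiplier
`Θ̃(ξ) = Θ_ξ(−2πξ)` of `suzukiK`. Valid for every `ψ : ℝ → ℂ` (both sides are the same Bochner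
integral, junk included). RH-FREE. [cite: Suzuki2025WeilHilbertSpace, CJM eq. (1.1) p. 2 and eq. (5.8) p. 15 ("2π‖ψ‖² = ‖ψ̂‖²") (= arXiv v1 p. 2 L27–30)] -/
theorem suzukiHat_ofReal_eq_fourier (ψ : ℝ → ℂ) (u : ℝ) :
    suzukiHat ψ u = 𝓕 ψ (-u / (2 * Real.pi)) := by
  rw [Real.fourier_real_eq_integral_exp_smul]
  unfold suzukiHat
  congr 1 with x
  rw [smul_eq_mul, mul_comm]
  congr 1
  have hπ : (Real.pi : ℂ) ≠ 0 := by exact_mod_cast Real.pi_ne_zero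
  push_cast
  field_simp

/-- For `ψ` vanishing a.e. on `(−∞,0)` the whole-line transform `ψ̂(z)` IS the half-line transform
`∫₀^∞ ψ(x)e^{izx}dx` of the `Defs` module (`upperHalfHat`), at every `z`. RH-FREE.
[cite: Suzuki2025WeilHilbertSpace, CJM §2.3 p. 5 ("H² = 𝖥(L²(0,∞))")] -/
theorem suzukiHat_eq_upperHalfHat {ψ : ℝ → ℂ} (hψ : ∀ᵐ x : ℝ, x < 0 → ψ x = 0) (z : ℂ) :
    suzukiHat ψ z = upperHalfHat ψ z := by
  unfold suzukiHat upperHalfHat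
  refine (setIntegral_eq_integral_of_ae_compl_eq_zero ?_).symm
  have h0 : ∀ᵐ x : ℝ, x ≠ 0 := by
    have : ({0}ᶜ : Set ℝ) ∈ ae (volume : Measure ℝ) := by
      rw [compl_mem_ae_iff, measure_singleton]
    exact this
  filter_upwards [hψ, h0] with x hx hx0 hxI
  rw [mem_Ioi, not_lt] at hxI
  rw [hx (lt_of_le_of_ne hxI hx0), zero_mul]

/-! ## E. The statements printed under "Assume that the RH is true" (RH-CONSEQUENCES, named facts)

None of these is a discharge target of the cell (their proofs ARE de Branges–model-space theory for
`E_ξ ∈ HB`, available only under RH); they are vendored as published theorems `RiemannHypothesis → …`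
over the `Defs` objects, with the evaluation `ψ̂(γ)` in the junk-free sense `HasHatValue` (under RH
every `γ ∈ Γ` is real and `ψ̂ = F/E_ξ` is analytic across `ℝ`, CJM §5, so the boundary-limit clause
is the printed value). -/

/-- `E_ξ · 𝖥(V(t))` — the `t`-th space of Suzuki's chain: the ENTIRE functions `Φ` with
`Φ(z) = E_ξ(z) f̂(z)` on `ℂ₊` for some `f ∈ V(t)` (`f̂(z) = ∫₀^∞ f(x)e^{izx}dx` there, `f` vanishing
on `(−∞,t)`). Printed "`E 𝖥(V(t)) = {E(z)ψ̂(z) | ψ ∈ V(t)}`", where `E ψ̂` is shown (under RH, proof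
of Thm. 5.7) to continue to an entire function; an entire function is determined by its values on
`ℂ₊`, so this set IS the printed one whenever the continuation exists, and contains no junk
otherwise. RH-FREE object. [cite: Suzuki2025WeilHilbertSpace, CJM Lemma 5.1 p. 13 and Thm. 5.7 p. 16 (= arXiv v1 Thm. 1.2 (1), (4) p. 3)] -/
def suzukiChainSpace (t : ℝ) : Set (ℂ → ℂ) :=
  {Φ | Differentiable ℂ Φ ∧
    ∃ f ∈ suzukiV t, ∀ z : ℂ, 0 < z.im → Φ z = lagariasE z * upperHalfHat f z}

/-- **RH-CONSEQUENCE. CJM Lemma 5.1 (= arXiv v1 Thm. 1.2 (1)): under RH, `𝓗(E_ξ) = E_ξ𝖥(V(0))`.**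
"Let `V(0) = L²(0,∞) ∩ 𝖪L²(0,∞)`. Then, we have `𝓚(Θ) = 𝖥(V(0))`, and hence
`𝓗(E) = E𝖥(V(0)) = {E(z)ψ̂(z) | ψ ∈ V(0)}`." Typed: the second clause, over the tree's de
Branges space `Literature.Analysis.DeBrangesSpaces.DeBrangesSpace lagariasE` (Romanov's pointwise
characterization, which is Suzuki's `F/E, F♯/E ∈ H²` definition (2.4) for `E` Hermite–Biehler —
the case under the RH binder, [La06, Thm. 1]) and `suzukiChainSpace 0`. The first clause (model
space `𝓚(Θ) = H² ⊖ ΘH²`) is not typed (no `H²(ℂ₊)` vocabulary in the tree). Printed proof: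
[Su20a, Lemma 4.1] via `(𝖥𝖪ψ)(z) = Θ(z)(𝖥ψ)♯(z)` and (2.7).
[cite: Suzuki2025WeilHilbertSpace, CJM Lemma 5.1 p. 13 (TeX l.1464–1471) (= arXiv v1 Thm. 1.2 (1) p. 3 L10)] -/
def Suzuki2025_lemma51 : Prop :=
  RiemannHypothesis →
    suzukiChainSpace 0 = (DeBrangesSpace lagariasE : Set (ℂ → ℂ))

/-- **RH-CONSEQUENCE. CJM Lemma 5.3 (isomorphism `V(0) ≅ L²(τ)`, eq. (5.5)).** "Hilbert spaces
`V(0)` and `L²(τ)` are isomorphic by the linear map `V(0) ∋ ψ ↦ S_ψ := (ψ̂(γ))_{γ∈Γ} ∈ L²(τ)` with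
`2‖ψ‖²_{L²(ℝ)} = ‖S_ψ‖²_{L²(τ)}`", where `‖S‖²_{L²(τ)} = Σ_γ m_γ|S(γ)|²` (5.4) (`τ` the spectral
measure of the screw function `g_ξ`, `= Σ m_γ δ_γ` under RH, (5.3)). Typed as three clauses under
the RH binder: (a) every `ψ ∈ V(0)` HAS a value `ψ̂(γ)` at every `γ ∈ Γ` (`S_ψ` is defined);
(b) isometry (5.5): `Σ_ρ m(ρ)|ψ̂(γ_ρ)|² = 2‖ψ‖²` for every compatible value assignment;
(c) surjectivity: every `S` with `Σ m(ρ)|S(γ_ρ)|² < ∞` is `S_ψ` for some `ψ ∈ V(0)` (injectivity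
follows from (b) and linearity, `hasHatValue_sub`). This is the typed content of the ISOMORPHISM
clause of Thm. 1.1 / Thm. 5.5 (2) (`𝓗_W ≅ L²(τ)`, Lemma 5.4, needs the completion `𝓗_W` and is
not typed). [cite: Suzuki2025WeilHilbertSpace, CJM Lemma 5.3 p. 14 (TeX l.1545–1558), eq. (5.4)–(5.5)] -/
def Suzuki2025_lemma53 : Prop :=
  RiemannHypothesis →
    (∀ ψ ∈ suzukiV 0, ∃ c : ℂ → ℂ, ∀ ρ ∈ ZetaZeros.riemannZetaNontrivialZeros,
        HasHatValue ψ (suzukiZeroParam ρ) (c (suzukiZeroParam ρ))) ∧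
    (∀ ψ ∈ suzukiV 0, ∀ c : ℂ → ℂ,
      (∀ ρ ∈ ZetaZeros.riemannZetaNontrivialZeros,
          HasHatValue ψ (suzukiZeroParam ρ) (c (suzukiZeroParam ρ))) →
        HasSum (fun ρ : ZetaZeros.riemannZetaNontrivialZeros ↦
          (riemannZetaZeroOrder (ρ : ℂ) : ℝ) * ‖c (suzukiZeroParam ρ)‖ ^ 2) (2 * ‖ψ‖ ^ 2)) ∧
    (∀ S : ℂ → ℂ,
      Summable (fun ρ : ZetaZeros.riemannZetaNontrivialZeros ↦
          (riemannZetaZeroOrder (ρ : ℂ) : ℝ) * ‖S (suzukiZeroParam ρ)‖ ^ 2) →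
        ∃ ψ ∈ suzukiV 0, ∀ ρ ∈ ZetaZeros.riemannZetaNontrivialZeros,
          HasHatValue ψ (suzukiZeroParam ρ) (S (suzukiZeroParam ρ)))

/-- **RH-CONSEQUENCE. CJM Thm. 5.5 (1) (= arXiv v1 Thm. 1.2 (2); the norm identity of Thm. 1.1).**
"Assume that the RH is true. … (1) `‖Eψ̂‖²_{𝓗(E)} = ‖ψ̂‖²_{L²(ℝ)} = 2π‖ψ‖²_{L²(ℝ)} = π⟨ψ,ψ⟩_W`
for `ψ ∈ V(0)`." The first equality is the definition (2.4) of the `𝓗(E)`-norm, the second is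
Plancherel in the convention (1.1); the CONTENT is the third, "(5.10) `‖ψ‖² = ½⟨ψ,ψ⟩_W`", i.e.
`WeilNormIdentityOn (suzukiV 0)` (Thm. 1.1: "`‖E_ξF‖²_{𝓗(E_ξ)} = ‖F‖²_{𝓚(Θ_ξ)} = π⟨ψ_F,ψ_F⟩_W`",
`ψ_F = 𝖥⁻¹F`, is the same identity on `𝓚(Θ) = 𝖥(V(0))`, Lemma 5.1). Printed proof: the orthogonal
basis `ψ_γ` (`Suzuki2025_orthogonalBasis`) and (4.2). Its converse direction is not in print; the
conjunction with condition (2) is RH-EQUIVALENT (`Suzuki2025_prop58`).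
[cite: Suzuki2025WeilHilbertSpace, CJM Thm. 5.5 (1) p. 15 (TeX l.1676–1690), eq. (5.10); Thm. 1.1 p. 2 (= arXiv v1 Thm. 1.2 (2), Thm. 1.1)] -/
def Suzuki2025_thm55_normIdentity : Prop :=
  RiemannHypothesis → WeilNormIdentityOn (suzukiV 0)

/-- **RH-CONSEQUENCE. The orthogonal basis `{ψ_γ}_{γ∈Γ}` of `V(0)` (CJM Prop. 4.1 with (3.5), (4.2),
transported by Lemma 5.1 and (5.11)).** Under RH: `F_γ(z) := √(m_γ/π)·i(1 + Θ(z))/(2(z − γ))`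
(3.5) "forms an orthonormal basis of `𝓚(Θ)`" with "`F_γ(γ) = 1/√(m_γπ)`, `F_γ(γ′) = 0` for every
`γ′ ∈ Γ∖{γ}`" (4.2); "`F_γ = ψ̂_γ` … each `ψ_γ` belongs to `V(0)`, and `{ψ_γ}_{γ∈Γ}` forms an
orthogonal basis satisfying `2π‖ψ_γ‖²_{L²(ℝ)} = ‖F_γ‖²_{𝓚(Θ)} = 1`" (proof of Thm. 5.5 (1),
(5.11)). Typed over `V(0)` (indexed by the zeros `ρ`, `γ = γ(ρ)`): membership, the values (4.2) in
the sense of `HasHatValue`, the normalisation, pairwise `L²`-orthogonality, and completeness in the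
closed subspace `V(0)` (only `0 ∈ V(0)` is orthogonal to every `ψ_γ`). The explicit formula (3.5)
for `𝖥ψ_γ` is recorded here, not typed (it needs the `L²`-class of `F_γ|_ℝ`, [Su23, Prop. 3.2]).
[cite: Suzuki2025WeilHilbertSpace, CJM Prop. 4.1 p. 10 (TeX l.1120–1139), eq. (3.5), (4.2), (5.11) (= arXiv v1 (3.4)–(3.6) p. 6)] -/
def Suzuki2025_orthogonalBasis : Prop :=
  RiemannHypothesis →
    ∃ ψb : ℂ → Lp ℂ 2 (volume : Measure ℝ),
      (∀ ρ ∈ ZetaZeros.riemannZetaNontrivialZeros, ψb ρ ∈ suzukiV 0) ∧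
      (∀ ρ ∈ ZetaZeros.riemannZetaNontrivialZeros, HasHatValue (ψb ρ) (suzukiZeroParam ρ)
          (((Real.sqrt ((riemannZetaZeroOrder ρ : ℝ) * Real.pi))⁻¹ : ℝ) : ℂ)) ∧
      (∀ ρ ∈ ZetaZeros.riemannZetaNontrivialZeros, ∀ ρ' ∈ ZetaZeros.riemannZetaNontrivialZeros,
          ρ' ≠ ρ → HasHatValue (ψb ρ) (suzukiZeroParam ρ') 0) ∧
      (∀ ρ ∈ ZetaZeros.riemannZetaNontrivialZeros, 2 * Real.pi * ‖ψb ρ‖ ^ 2 = 1) ∧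
      (∀ ρ ∈ ZetaZeros.riemannZetaNontrivialZeros, ∀ ρ' ∈ ZetaZeros.riemannZetaNontrivialZeros,
          ρ' ≠ ρ → inner ℂ (ψb ρ) (ψb ρ') = 0) ∧
      (∀ ψ ∈ suzukiV 0,
          (∀ ρ ∈ ZetaZeros.riemannZetaNontrivialZeros, inner ℂ (ψb ρ) ψ = 0) → ψ = 0)

/-- On the real axis the Blaschke-type factor `(z − w̄)/(z − w)` has modulus one, so
`Ψ = ((· − w̄)/(· − w))Φ` has the same `𝓗(E)`-norm as `Φ` — the norm equality of axiom (dB3)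
("trivial by the definition of the norm of `𝓗`", proof of Thm. 5.7). RH-FREE, proved.
[cite: Suzuki2025WeilHilbertSpace, CJM Thm. 5.7 p. 16, proof, axiom (dB3) (TeX l.1873–1880)] -/
theorem deBrangesNormSq_blaschke_mul (E Φ Ψ : ℂ → ℂ) {w : ℂ} (hw : w.im ≠ 0)
    (h : ∀ z : ℂ, z ≠ w → Ψ z = (z - conj w) / (z - w) * Φ z) :
    deBrangesNormSq E Ψ = deBrangesNormSq E Φ := by
  unfold deBrangesNormSq
  congr 1 with x
  have hx : (x : ℂ) ≠ w := fun e ↦ hw (by rw [← e, Complex.ofReal_im])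
  have hx' : (x : ℂ) - w ≠ 0 := sub_ne_zero.2 hx
  have hb : ‖((x : ℂ) - conj w) / ((x : ℂ) - w)‖ = 1 := by
    rw [norm_div, div_eq_one_iff_eq (norm_ne_zero_iff.2 hx')]
    have : (x : ℂ) - conj w = conj ((x : ℂ) - w) := by
      rw [map_sub, Complex.conj_ofReal]
    rw [this, Complex.norm_conj]
  rw [h x hx, mul_div_assoc, norm_mul, hb, one_mul]

/-- **RH-CONSEQUENCE. CJM Thm. 5.7 (= arXiv v1 Thm. 1.2 (4)): the chain of de Branges subspaces.**
"Assume that the RH is true. Then, `E𝖥(V(t))` is a de Branges subspace of `𝓗(E)` for every `t ≥ 0`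
and is isometrically isomorphic to `𝓗_W(t)` up to a constant multiple by the map of Theorem 1.1."
Typed (first half; `𝓗_W(t) := {[ψ] | ψ ∈ V(t)}` needs `𝓗_W`): for `t ≥ 0`, with
`𝓗 := suzukiChainSpace t`: `𝓗 ⊆ 𝓗(E_ξ)`; the printed axioms (dB1) "for each `z ∉ ℝ` the point
evaluation is a continuous linear functional on `𝓗`" (as a uniform bound by the `𝓗(E)`-norm
`deBrangesNormSq`), (dB2) "`Φ♯ ∈ 𝓗` and `‖Φ♯‖ = ‖Φ‖`" (the norm equality is the tree's
`deBrangesNormSq_sharp`), (dB3) "if `Φ(w) = 0`, `w ∉ ℝ`, then `((z − w̄)/(z − w))Φ(z) ∈ 𝓗` with the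
same norm" (the quotient has a removable singularity at `w`: typed as an element `Ψ ∈ 𝓗` agreeing
with it off `w`; norm equality `deBrangesNormSq_blaschke_mul`); and "the Hilbert space structure is
the one induced from `V(t)`, equivalent to `⟨F,G⟩_𝓗 = ∫ F Ḡ |E|⁻²`": `‖E f̂‖²_{𝓗(E)} = 2π‖f‖²`.
[cite: Suzuki2025WeilHilbertSpace, CJM Thm. 5.7 p. 16 (TeX l.1844–1897), axioms (dB1)–(dB3) (= arXiv v1 Thm. 1.2 (4) p. 3 L33)] -/
def Suzuki2025_thm57 : Prop :=
  RiemannHypothesis → ∀ t : ℝ, 0 ≤ t →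
    suzukiChainSpace t ⊆ (DeBrangesSpace lagariasE : Set (ℂ → ℂ)) ∧
    (∀ z : ℂ, z.im ≠ 0 → ∃ C : ℝ, ∀ Φ ∈ suzukiChainSpace t,
        ‖Φ z‖ ^ 2 ≤ C * deBrangesNormSq lagariasE Φ) ∧
    (∀ Φ ∈ suzukiChainSpace t, sharp Φ ∈ suzukiChainSpace t) ∧
    (∀ Φ ∈ suzukiChainSpace t, ∀ w : ℂ, w.im ≠ 0 → Φ w = 0 →
        ∃ Ψ ∈ suzukiChainSpace t, ∀ z : ℂ, z ≠ w → Ψ z = (z - conj w) / (z - w) * Φ z) ∧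
    (∀ Φ : ℂ → ℂ, ∀ f ∈ suzukiV t, Differentiable ℂ Φ →
        (∀ z : ℂ, 0 < z.im → Φ z = lagariasE z * upperHalfHat f z) →
          deBrangesNormSq lagariasE Φ = 2 * Real.pi * ‖f‖ ^ 2)

/-- **RH-EQUIVALENT (l.1)·PRINTED. CJM Prop. 5.8 (= arXiv v1 Thm. 1.3; the cell's declared residual
`IsolatedV0` is its right-hand side).** "Let `V(0) = L²(0,∞) ∩ 𝖪L²(0,∞)` be as in (5.2). Then the
RH is true if and only if the following two conditions hold: (1) `‖ψ‖²_{L²(ℝ)} = 2⁻¹⟨ψ,ψ⟩_W` for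
every `ψ ∈ V(0)`. (2) For a given `γ ∈ Γ` and any `ε > 0`, there exists `ψ ∈ V(0)` such that
`ψ̂(−γ) = 1`, `|ψ̂(−γ′)| ≤ ε/|γ − γ′|^{1+δ}` for every `γ′ ∈ Γ∖{γ}` for some `δ > 0` independent
of `γ`, `ε`, and `ψ`." (Suzuki: "a weaker variant of Corollary 1.5 … since the construction of
`V(0)` is simpler than that of `V°(0)`, more conditions are required".) The `−γ` form is the typed
`γ` form by the cell's `weilNormIdentityOn_iff_neg` / `zeroSeparationOn_iff_neg`
(`SuzukiWeilHatValueProofs.lean`). DIRECTIONS: `⟹` is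
`Suzuki2025_prop58_mp_of` over the RH-CONSEQUENCES `Suzuki2025_thm55_normIdentity` and
`Suzuki2025_orthogonalBasis` (printed proof: "(1) follows from Theorem 5.5 (1). Also, (2) holds,
since `ψ_γ = 𝖥⁻¹(F_γ)` in `V(0)` satisfies `ψ̂_γ(γ) ≠ 0` and `ψ̂_γ(γ′) = 0`"); `⟸` (Weil-sign
argument at a non-real `γ₀`, 8 printed lines) is the RH-FREE door PROVED Summits-side as
`Summit.RiemannHypothesis.RiemannHypothesis.Theorems.DeBrangesChain.chainDoorV0_proof`, with exactly
the signature of the hypothesis `hdoor` of `Suzuki2025_prop58_of` (not re-declared in Literature).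
A refutation-budget statement; NOBODY's proving target.
[cite: Suzuki2025WeilHilbertSpace, CJM Prop. 5.8 p. 17 (TeX l.1953–1999) (= arXiv v1 Thm. 1.3 p. 3 L75–90, proof §3.4 p. 7)] -/
def Suzuki2025_prop58 : Prop :=
  RiemannHypothesis ↔ (WeilNormIdentityOn (suzukiV 0) ∧ ZeroSeparationOn (suzukiV 0))

/-! ### Derived theorems (proved) -/

/-- **Condition (2) under RH from the basis** (printed proof of Prop. 5.8, necessity of (2)):
`ψ := √(m_γπ)·ψ_γ ∈ V(0)` has `ψ̂(γ) = 1` and `ψ̂(γ′) = 0`, so (2) holds with any `δ` (here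
`δ = 1`) and the bound `0 ≤ ε/|γ − γ′|^{1+δ}`. PROVED modulo the RH-CONSEQUENCE
`Suzuki2025_orthogonalBasis`. [cite: Suzuki2025WeilHilbertSpace, CJM Prop. 5.8 p. 17, proof (TeX l.1973–1977)] -/
theorem zeroSeparationOn_of_orthogonalBasis (hB : Suzuki2025_orthogonalBasis)
    (hRH : RiemannHypothesis) : ZeroSeparationOn (suzukiV 0) := by
  obtain ⟨ψb, hV, hval, hvan, -, -, -⟩ := hB hRH
  refine ⟨1, one_pos, fun ρ hρ ε hε ↦ ?_⟩
  set a : ℝ := Real.sqrt ((riemannZetaZeroOrder ρ : ℝ) * Real.pi) with ha_def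
  have hm : (1 : ℝ) ≤ riemannZetaZeroOrder ρ := by
    exact_mod_cast ZetaZeros.riemannZetaNontrivialZeros.one_le_order hρ
  have ha : 0 < a := Real.sqrt_pos.2 (by positivity)
  refine ⟨(a : ℂ) • ψb ρ, (suzukiVSubmodule 0).smul_mem _ (hV ρ hρ), ?_,
    fun ρ' hρ' hne ↦ ⟨0, ?_, ?_⟩⟩
  · have h := hasHatValue_smul (a : ℂ) (hval ρ hρ)
    have e : (a : ℂ) * (((a⁻¹ : ℝ)) : ℂ) = 1 := by
      rw [Complex.ofReal_inv, mul_inv_cancel₀]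
      exact_mod_cast ha.ne'
    rwa [e] at h
  · simpa using hasHatValue_smul (a : ℂ) (hvan ρ hρ ρ' hρ' hne)
  · rw [norm_zero]; positivity

/-- **Prop. 5.8 `⟹`** (RH ⟹ (1) ∧ (2)), PROVED modulo the two RH-CONSEQUENCES it is printed to
follow from (Thm. 5.5 (1) and the basis `ψ_γ`).
[cite: Suzuki2025WeilHilbertSpace, CJM Prop. 5.8 p. 17, proof of necessity (TeX l.1972–1977)] -/
theorem Suzuki2025_prop58_mp_of (h55 : Suzuki2025_thm55_normIdentity)
    (hB : Suzuki2025_orthogonalBasis) (hRH : RiemannHypothesis) :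
    WeilNormIdentityOn (suzukiV 0) ∧ ZeroSeparationOn (suzukiV 0) :=
  ⟨h55 hRH, zeroSeparationOn_of_orthogonalBasis hB hRH⟩

/-- **Prop. 5.8 assembled**: the printed equivalence follows from the two RH-CONSEQUENCE facts and
the RH-FREE door `(1) ∧ (2) → RH` (hypothesis `hdoor`; its proof term is the Summits-side
`DeBrangesChain.chainDoorV0_proof`, which Literature cannot import). PROVED glue.
[cite: Suzuki2025WeilHilbertSpace, CJM Prop. 5.8 p. 17 (TeX l.1953–1999)] -/
theorem Suzuki2025_prop58_of (h55 : Suzuki2025_thm55_normIdentity)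
    (hB : Suzuki2025_orthogonalBasis)
    (hdoor : WeilNormIdentityOn (suzukiV 0) ∧ ZeroSeparationOn (suzukiV 0) → RiemannHypothesis) :
    Suzuki2025_prop58 :=
  ⟨Suzuki2025_prop58_mp_of h55 hB, hdoor⟩

/-- Remark 5.2 under RH: each zero `γ` yields a NONZERO element `ψ_γ` of `V(0)` (its value at `γ` is
`1/√(m_γπ) ≠ 0`, while the zero class has only the value `0`, `HasHatValue.eq_zero_of_zero`).
PROVED modulo `Suzuki2025_orthogonalBasis`. [cite: Suzuki2025WeilHilbertSpace, CJM Remark 5.2 p. 14 (TeX l.1500–1504)] -/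
theorem exists_ne_zero_mem_suzukiV_zero_of_basis (hB : Suzuki2025_orthogonalBasis)
    (hRH : RiemannHypothesis) {ρ : ℂ} (hρ : ρ ∈ ZetaZeros.riemannZetaNontrivialZeros) :
    ∃ ψ ∈ suzukiV 0, ψ ≠ 0 := by
  obtain ⟨ψb, hV, hval, -⟩ := hB hRH
  refine ⟨ψb ρ, hV ρ hρ, fun h0 ↦ ?_⟩
  have h := hval ρ hρ
  rw [h0] at h
  have hz := h.eq_zero_of_zero
  have hm : (1 : ℝ) ≤ riemannZetaZeroOrder ρ := by
    exact_mod_cast ZetaZeros.riemannZetaNontrivialZeros.one_le_order hρ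
  have ha : 0 < Real.sqrt ((riemannZetaZeroOrder ρ : ℝ) * Real.pi) :=
    Real.sqrt_pos.2 (by positivity)
  have : ((Real.sqrt ((riemannZetaZeroOrder ρ : ℝ) * Real.pi))⁻¹ : ℝ) = 0 := by exact_mod_cast hz
  exact (inv_ne_zero ha.ne') this

/-- **Remark 5.2: "the RH would be false if `V(0) = {0}`"**, i.e. RH ⟹ `V(0) ≠ {0}` — PROVED modulo
`Suzuki2025_orthogonalBasis`, given one non-trivial zero (the tree has them, e.g.
`exists_zero_of_zetaOrdinate_holds`; kept as a hypothesis to keep this module's imports light).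
Suzuki's question "prove or disprove `V(0) ≠ {0}` UNCONDITIONALLY" is OPEN IN PRINT and is not a
fact of this file. [cite: Suzuki2025WeilHilbertSpace, CJM Remark 5.2 p. 14 (TeX l.1500–1510) (= arXiv v1 p. 3 L41–44)] -/
theorem suzukiV_zero_ne_singleton_of_basis (hB : Suzuki2025_orthogonalBasis)
    (hRH : RiemannHypothesis) (hne : ZetaZeros.riemannZetaNontrivialZeros.Nonempty) :
    suzukiV 0 ≠ {0} := by
  obtain ⟨ρ, hρ⟩ := hne
  obtain ⟨ψ, hψ, hψ0⟩ := exists_ne_zero_mem_suzukiV_zero_of_basis hB hRH hρ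
  intro h
  rw [h] at hψ
  exact hψ0 hψ

/-! ## F. Plancherel in the convention (1.1) (CJM (5.8)) and Cor. 1.5: the space `V°(0)` -/

/-- `‖F‖² = ∫ ‖F(ξ)‖² dξ` for a class `F ∈ L²(ℝ)` (`‖F‖² = re⟪F,F⟫` and `L2.inner_def`). [folklore] -/
private theorem norm_sq_eq_integral_norm_sq_aux (F : Lp ℂ 2 (volume : Measure ℝ)) :
    ‖F‖ ^ 2 = ∫ ξ : ℝ, ‖(F : ℝ → ℂ) ξ‖ ^ 2 := by
  have h1 : inner ℂ F F = ((‖F‖ ^ 2 : ℝ) : ℂ) := by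
    rw [inner_self_eq_norm_sq_to_K]; norm_cast
  have h2 : inner ℂ F F = ((∫ ξ : ℝ, ‖(F : ℝ → ℂ) ξ‖ ^ 2 : ℝ) : ℂ) := by
    rw [L2.inner_def, ← integral_complex_ofReal]
    refine integral_congr_ae (ae_of_all _ fun ξ ↦ ?_)
    beta_reduce
    rw [inner_self_eq_norm_sq_to_K]
    norm_cast
  exact_mod_cast Complex.ofReal_injective (h1.symm.trans h2)

/-- The substitution of the convention bookkeeping (`u = −2πξ`): `∫ g(−2πξ) dξ = (2π)⁻¹ ∫ g(u) du`
(Lebesgue measure scales by `|−2π|⁻¹`; valid for every `g`, junk values included). [folklore] -/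
private theorem integral_comp_neg_two_pi_mul (g : ℝ → ℝ) :
    ∫ ξ : ℝ, g (-(2 * Real.pi) * ξ) = (2 * Real.pi)⁻¹ * ∫ u : ℝ, g u := by
  rw [Measure.integral_comp_mul_left g (-(2 * Real.pi)), smul_eq_mul, abs_inv, abs_neg,
    abs_of_pos Real.two_pi_pos]

/-- **CJM (5.8) / Thm. 5.5 (1), middle equality — `‖ψ̂‖²_{L²(ℝ)} = 2π‖ψ‖²_{L²(ℝ)}` in the
convention (1.1)**, for `ψ ∈ L¹(ℝ) ∩ L²(ℝ)`: `∫ |ψ̂(u)|² du = 2π ∫ |ψ(x)|² dx`. Proof: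
`ψ̂(u) = (𝓕ψ)(−u/2π)` (`suzukiHat_ofReal_eq_fourier`), the substitution `u = −2πw`, and Plancherel
for `L¹ ∩ L²` in Mathlib's normalisation (the tree's `integral_norm_sq_fourierIntegral_eq`). This is
Suzuki's "The Fourier transform `𝖥` is an isometry up to a constant factor" made quantitative.
RH-FREE, PROVED. [cite: Suzuki2025WeilHilbertSpace, CJM eq. (5.8) p. 15 (TeX l.1697: "2π‖ψ‖² = ‖ψ̂‖²") and Thm. 5.5 (1) (TeX l.1680–1688) (= arXiv v1 Thm. 1.2 (2), proof p. 6 L25–30)] -/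
theorem integral_norm_sq_suzukiHat {ψ : ℝ → ℂ} (h1 : Integrable ψ) (h2 : MemLp ψ 2 volume) :
    ∫ u : ℝ, ‖suzukiHat ψ u‖ ^ 2 = 2 * Real.pi * ∫ x : ℝ, ‖ψ x‖ ^ 2 := by
  have h : (fun u : ℝ ↦ ‖suzukiHat ψ u‖ ^ 2) =
      fun u : ℝ ↦ (fun w : ℝ ↦ ‖𝓕 ψ w‖ ^ 2) ((-(2 * Real.pi))⁻¹ * u) := by
    funext u
    rw [suzukiHat_ofReal_eq_fourier]
    congr 3
    field_simp
  rw [h, Measure.integral_comp_mul_left (fun w : ℝ ↦ ‖𝓕 ψ w‖ ^ 2) ((-(2 * Real.pi))⁻¹),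
    inv_inv, abs_neg, abs_of_pos Real.two_pi_pos, smul_eq_mul,
    Literature.Analysis.FunctionSpaces.integral_norm_sq_fourierIntegral_eq h1 h2]

/-- **CJM (5.8) for classes `ψ ∈ L²(ℝ)`**: with Suzuki's `(𝖥ψ)(u) = (𝓕ψ)(−u/2π)` (the `Defs`
convention bookkeeping; `𝓕` Mathlib's unitary transform of the class `ψ`),
`‖𝖥ψ‖²_{L²(ℝ)} = ∫ |(𝓕ψ)(−u/2π)|² du = 2π‖ψ‖²_{L²(ℝ)}`. RH-FREE, PROVED (Plancherel
`Lp.norm_fourier_eq` + the substitution). [cite: Suzuki2025WeilHilbertSpace, CJM eq. (5.8) p. 15 (TeX l.1697) and §5 p. 13 (TeX l.1444: "𝖥 is an isometry up to a constant factor")] -/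
theorem integral_norm_sq_fourier_dilate (ψ : Lp ℂ 2 (volume : Measure ℝ)) :
    ∫ u : ℝ, ‖((𝓕 ψ : Lp ℂ 2 (volume : Measure ℝ)) : ℝ → ℂ) (-u / (2 * Real.pi))‖ ^ 2 =
      2 * Real.pi * ‖ψ‖ ^ 2 := by
  set F : Lp ℂ 2 (volume : Measure ℝ) := 𝓕 ψ with hF
  have h : (fun u : ℝ ↦ ‖(F : ℝ → ℂ) (-u / (2 * Real.pi))‖ ^ 2) =
      fun u : ℝ ↦ (fun w : ℝ ↦ ‖(F : ℝ → ℂ) w‖ ^ 2) ((-(2 * Real.pi))⁻¹ * u) := by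
    funext u
    congr 3
    field_simp
  rw [h, Measure.integral_comp_mul_left (fun w : ℝ ↦ ‖(F : ℝ → ℂ) w‖ ^ 2) ((-(2 * Real.pi))⁻¹),
    inv_inv, abs_neg, abs_of_pos Real.two_pi_pos, smul_eq_mul,
    ← norm_sq_eq_integral_norm_sq_aux, hF, Lp.norm_fourier_eq]

/-- `L²` is stable under the dilations `ξ ↦ aξ`, `a ≠ 0` (Lebesgue measure is quasi-invariant:
`(a·)_* vol = |a|⁻¹ vol`). [folklore] -/
private theorem memLp_two_comp_mul_left {P : ℝ → ℂ} (hP : MemLp P 2 volume) {a : ℝ}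
    (ha : a ≠ 0) :
    MemLp (fun ξ : ℝ ↦ P (a * ξ)) 2 volume :=
  (hP.smul_measure ENNReal.ofReal_ne_top).comp_measurePreserving
    ⟨measurable_const_mul a, Real.map_volume_mul_left ha⟩

/-- For `ψ ∈ L¹(ℝ) ∩ L²(ℝ)` the transform `ψ̂` of (1.1) is square-integrable on the real line
(Plancherel; the membership half of CJM (5.8) "`2π‖ψ‖² = ‖ψ̂‖²`"). RH-FREE, PROVED.
[cite: Suzuki2025WeilHilbertSpace, CJM eq. (5.8) p. 15 (TeX l.1697) (= arXiv v1 Thm. 1.2 (2), proof p. 6 L25–30)] -/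
theorem memLp_two_suzukiHat {ψ : ℝ → ℂ} (h1 : Integrable ψ) (h2 : MemLp ψ 2 volume) :
    MemLp (fun u : ℝ ↦ suzukiHat ψ u) 2 volume := by
  have h : (fun u : ℝ ↦ suzukiHat ψ u) = fun u : ℝ ↦ 𝓕 ψ ((-(2 * Real.pi))⁻¹ * u) := by
    funext u
    rw [suzukiHat_ofReal_eq_fourier, show -u / (2 * Real.pi) = (-(2 * Real.pi))⁻¹ * u by ring]
  rw [h]
  exact memLp_two_comp_mul_left
    (Literature.Analysis.FunctionSpaces.memLp_two_fourierIntegral h1 h2)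
    (inv_ne_zero (neg_ne_zero.2 Real.two_pi_pos.ne'))

/-- The differential operator `D` (1.8) preserves `C_c^∞(ℝ)`. [cite: Suzuki2025WeilHilbertSpace, CJM eq. (1.8) p. 3 (TeX l.414–415) and §4.3 (TeX l.1346: "D gives a bijection from C_c^∞(ℝ) to C_0^∞(ℝ)")] -/
theorem IsWeilTest.suzukiD {ψ : ℝ → ℂ} (hψ : IsWeilTest ψ) : IsWeilTest (suzukiD ψ) :=
  ⟨contDiff_const.mul hψ.deriv.1, hψ.deriv.2.mul_left⟩

/-- **"`ψ = 𝖥⁻¹P̂_{Dψ₀}`"** for a class `ψ ∈ L²(ℝ)` and a test function `ψ₀`: in the `Defs`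
convention (`(𝖥ψ)(u) = (𝓕ψ)(−u/2π)`, i.e. `(𝓕ψ)(ξ) = (𝖥ψ)(−2πξ)`) this is
"`(𝓕ψ)(ξ) = P̂_{Dψ₀}(−2πξ)` for a.e. `ξ`", `P̂_φ` = `screwPhat φ` (1.7), `D` = `suzukiD` (1.8) of the
cell's screw-line module. RH-FREE object. [cite: Suzuki2025WeilHilbertSpace, CJM Cor. 1.5 p. 3 (TeX l.438–444: "V°(0) := {𝖥⁻¹P̂_{Dψ} | ψ ∈ C_c^∞(ℝ)}")] -/
def IsVcircRep (ψ₀ : ℝ → ℂ) (ψ : Lp ℂ 2 (volume : Measure ℝ)) : Prop :=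
  ((𝓕 ψ : Lp ℂ 2 (volume : Measure ℝ)) : ℝ → ℂ) =ᵐ[volume]
    fun ξ : ℝ ↦ screwPhat (suzukiD ψ₀) ((-(2 * Real.pi) * ξ : ℝ) : ℂ)

/-- **Suzuki's space `V°(0) := {𝖥⁻¹P̂_{Dψ} | ψ ∈ C_c^∞(ℝ)} ⊂ L²(ℝ)`** (CJM Cor. 1.5), as a set of
`L²(ℝ)`-classes: those whose Fourier transform is (the dilate of) `P̂_{Dψ₀}` for some test function
`ψ₀`. For such `ψ₀`, `P̂_{Dψ₀} ∈ L²(ℝ)` is CJM Prop. 1.3 (`Suzuki2025_prop13`), so under that fact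
every test function generates an element (`exists_mem_suzukiVcirc`). Distinct from `V(0)` of (5.2)
(`suzukiV 0`); under RH `𝖥(V°(0))` is dense in `𝒦(Θ) = 𝖥(V(0))` (Thm. 5.6, not typed). RH-FREE object.
[cite: Suzuki2025WeilHilbertSpace, CJM Cor. 1.5 p. 3 (TeX l.438–444)] -/
def suzukiVcirc : Set (Lp ℂ 2 (volume : Measure ℝ)) :=
  {ψ | ∃ ψ₀ : ℝ → ℂ, IsWeilTest ψ₀ ∧ IsVcircRep ψ₀ ψ}

/-- Membership in `V°(0)`, unfolded. [cite: Suzuki2025WeilHilbertSpace, CJM Cor. 1.5 p. 3 (TeX l.438–444)] -/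
theorem mem_suzukiVcirc_iff {ψ : Lp ℂ 2 (volume : Measure ℝ)} :
    ψ ∈ suzukiVcirc ↔ ∃ ψ₀ : ℝ → ℂ, IsWeilTest ψ₀ ∧ IsVcircRep ψ₀ ψ := Iff.rfl

/-- **Plancherel on `V°(0)`**: if `ψ = 𝖥⁻¹P̂_{Dψ₀}` then `‖ψ‖²_{L²(ℝ)} = (2π)⁻¹‖P̂_{Dψ₀}‖²_{L²(ℝ)}`
("`‖ψ̂‖² = 2π‖ψ‖²`", (5.8), read backwards through `𝓕`). Both sides are honest for every class `ψ`
(if `P̂_{Dψ₀} ∉ L²` no class `ψ` satisfies the hypothesis). RH-FREE, PROVED.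
[cite: Suzuki2025WeilHilbertSpace, CJM proof of Cor. 1.5, §4.3 p. 12 (TeX l.1374–1377: "‖ψ̂₀‖² = 2π‖ψ₀‖² by (1.9) and Plancherel's identity")] -/
theorem norm_sq_of_isVcircRep {ψ₀ : ℝ → ℂ} {ψ : Lp ℂ 2 (volume : Measure ℝ)}
    (h : IsVcircRep ψ₀ ψ) :
    ‖ψ‖ ^ 2 = (2 * Real.pi)⁻¹ * ∫ x : ℝ, ‖screwPhat (suzukiD ψ₀) x‖ ^ 2 := by
  rw [← Lp.norm_fourier_eq ψ, norm_sq_eq_integral_norm_sq_aux]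
  have hae : (fun ξ : ℝ ↦ ‖((𝓕 ψ : Lp ℂ 2 (volume : Measure ℝ)) : ℝ → ℂ) ξ‖ ^ 2) =ᵐ[volume]
      fun ξ : ℝ ↦ (fun x : ℝ ↦ ‖screwPhat (suzukiD ψ₀) x‖ ^ 2) (-(2 * Real.pi) * ξ) := by
    filter_upwards [h] with ξ hξ
    rw [hξ]
  rw [integral_congr_ae hae]
  exact integral_comp_neg_two_pi_mul (fun x : ℝ ↦ ‖screwPhat (suzukiD ψ₀) x‖ ^ 2)

/-- **Every test function generates an element of `V°(0)`** (given CJM Prop. 1.3, `P̂_{Dψ₀} ∈ L²`):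
`ψ := 𝖥⁻¹P̂_{Dψ₀}` exists as an `L²`-class with `𝖥ψ = P̂_{Dψ₀}`. RH-FREE, PROVED modulo the RH-free
fact `Suzuki2025_prop13`. [cite: Suzuki2025WeilHilbertSpace, CJM Cor. 1.5 p. 3 (TeX l.438–444) with Prop. 1.3 (TeX l.392–405)] -/
theorem exists_mem_suzukiVcirc (h13 : Suzuki2025_prop13) {ψ₀ : ℝ → ℂ} (hψ₀ : IsWeilTest ψ₀) :
    ∃ ψ ∈ suzukiVcirc, IsVcircRep ψ₀ ψ := by
  have hP : MemLp (fun x : ℝ ↦ screwPhat (suzukiD ψ₀) x) 2 volume := h13 _ hψ₀.suzukiD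
  have hG : MemLp (fun ξ : ℝ ↦ screwPhat (suzukiD ψ₀) ((-(2 * Real.pi) * ξ : ℝ) : ℂ)) 2 volume :=
    memLp_two_comp_mul_left hP (neg_ne_zero.2 Real.two_pi_pos.ne')
  have hrep : IsVcircRep ψ₀ (𝓕⁻ (hG.toLp _) : Lp ℂ 2 (volume : Measure ℝ)) := by
    unfold IsVcircRep
    rw [FourierTransform.fourier_fourierInv_eq]
    exact hG.coeFn_toLp
  exact ⟨_, ⟨ψ₀, hψ₀, hrep⟩, hrep⟩

/-- `0 ∈ V°(0)` (generated by `ψ₀ = 0`: `D0 = 0`, `P̂_0 = 0`, `𝓕0 = 0`). [cite: Suzuki2025WeilHilbertSpace, CJM Cor. 1.5 p. 3 (V°(0) is a subspace of L²(ℝ))] -/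
theorem zero_mem_suzukiVcirc : (0 : Lp ℂ 2 (volume : Measure ℝ)) ∈ suzukiVcirc := by
  refine ⟨0, ⟨contDiff_const, HasCompactSupport.zero⟩, ?_⟩
  unfold IsVcircRep
  rw [FourierTransform.fourier_zero]
  have hD : suzukiD (0 : ℝ → ℂ) = 0 := by
    funext t; simp [suzukiD]
  have hP : ∀ z : ℂ, screwPhat (0 : ℝ → ℂ) z = 0 := fun z ↦ by simp [screwPhat]
  filter_upwards [Lp.coeFn_zero ℂ 2 (volume : Measure ℝ)] with ξ hξ
  rw [hξ, hD, hP, Pi.zero_apply]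

/-- **RH-CONSEQUENCE. CJM Thm. 5.6, last clause: under RH, `V(0)` is the `L²`-closure of
`V°(0)`.** "Let `𝓗₀` and `𝓚₀` be the Hilbert spaces defined unconditionally in Section 3.3. Assume
that the RH is true. Then `𝓗₀ = 𝓗_W` and `𝓚₀ = 𝓚(Θ)`, and the extended map `P̂_D : 𝓗_W → 𝓚(Θ)`
provides the inverse of the map in Theorem 5.5 (2). In particular, `V(0)` is the `L²`-closure of
`V°(0)` in Corollary 1.5." Typed: the last clause, over `suzukiVcirc` (Cor. 1.5) and `suzukiV 0`
((5.2), `Defs`). Not typed here: `𝓗₀ = 𝓗_W` and the inverse-map clause (need the completion `𝓗_W`,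
which exists only under RH — see "Not typed" in the module docstring); `𝓚₀ = 𝓚(Θ_ξ)` is a statement
about the screw-line module's `screwK0` / `modelSpaceL2` (cell row t7) and is left to it. Printed
proof: `‖P̂_{Dψ}‖² = π Σ m_γ|ψ̂(γ)|² = π⟨ψ,ψ⟩_W` by (1.2), (3.8), Prop. 4.1; `F(γ) = ψ̂(γ)` by (3.8),
(4.2). A published theorem under RH; NOT a discharge target of the cell.
[cite: Suzuki2025WeilHilbertSpace, CJM Thm. 5.6 p. 16 (TeX l.1799–1809: "In particular, V(0) is the L²-closure of V°(0)")] -/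
def Suzuki2025_thm56_closure : Prop :=
  RiemannHypothesis → closure suzukiVcirc = suzukiV 0

/-- **RH-EQUIVALENT (l.1)·PRINTED. CJM Cor. 1.5** (= corollary of Thm. 1.4): "Define the subspace
`V°(0)` of `L²(ℝ)` by `V°(0) := {𝖥⁻¹P̂_{Dψ} | ψ ∈ C_c^∞(ℝ)}`. Then the RH is true if and only if
the equality (1.10) `2‖ψ‖²_{L²(ℝ)} = ⟨ψ,ψ⟩_W` holds for all `ψ ∈ V°(0)`." READING OF `⟨ψ,ψ⟩_W` ON
`V°(0)` (elements of `L²(ℝ)`, not test functions): the printed proof (§4.3, TeX l.1359–1373) gives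
it meaning through the generating test function — "`ψ̂(z) = P̂_{Dψ₀}(z)` for some `ψ₀ ∈ C_c^∞(ℝ)` …
`ψ̂(γ) = ψ̂₀(γ)` by (3.8), (4.2). Therefore `⟨ψ,ψ⟩_W` is defined and satisfies
`⟨ψ,ψ⟩_W = ⟨ψ₀,ψ₀⟩_W`" — and this is how it is typed: for every test function `ψ₀` with
`𝖥ψ = P̂_{Dψ₀}` (`IsVcircRep ψ₀ ψ`), `2‖ψ‖² = ⟨ψ₀,ψ₀⟩_W` (`= weilQuadratic ψ₀`, COLUMN 2, as in the
cell's `Suzuki2025_thm14`); the intermediate claim "`ψ̂` is continuous on `ℝ` with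
`ψ̂(γ) = ψ̂₀(γ)`" ((3.8) + (4.2)) is recorded, not typed. With this reading Cor. 1.5 is Thm. 1.4
((1.9) `‖P̂_{Dψ}‖² = π⟨ψ,ψ⟩_W`) re-indexed by Plancherel — printed: "Equation (1.9) is reformulated
to the following simpler form" — and that reformulation is PROVED below
(`Suzuki2025_eq110_iff_eq19`, `Suzuki2025_cor15_of`), modulo CJM Prop. 1.3. Its RH-free half
"(1.10) ⟹ RH" is `Suzuki2025_cor15_if` (Weil's criterion). A refutation-budget statement
(C-class criterion); NOBODY's proving target. bears_on B-C/B-P.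
[cite: Suzuki2025WeilHilbertSpace, CJM Cor. 1.5 p. 3 (TeX l.438–451), proof §4.3 p. 12 (TeX l.1352–1380)] -/
def Suzuki2025_cor15 : Prop :=
  RiemannHypothesis ↔
    ∀ ψ ∈ suzukiVcirc, ∀ ψ₀ : ℝ → ℂ, IsWeilTest ψ₀ → IsVcircRep ψ₀ ψ →
      ((2 * ‖ψ‖ ^ 2 : ℝ) : ℂ) = weilQuadratic ψ₀

/-- **"Equation (1.9) is reformulated to the following simpler form"** (CJM p. 3, TeX l.436): given
CJM Prop. 1.3 (`P̂_{Dψ₀} ∈ L²` for test `ψ₀`), condition (1.10) on `V°(0)` is EQUIVALENT to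
condition (1.9) `‖P̂_{Dψ}‖² = π⟨ψ,ψ⟩_W` on `C_c^∞(ℝ)` — by `‖𝖥⁻¹P̂_{Dψ₀}‖² = (2π)⁻¹‖P̂_{Dψ₀}‖²`
(`norm_sq_of_isVcircRep`) and the existence of generated elements (`exists_mem_suzukiVcirc`).
RH-FREE, PROVED. [cite: Suzuki2025WeilHilbertSpace, CJM p. 3 (TeX l.436) and proof of Cor. 1.5 §4.3 p. 12 (TeX l.1352–1380)] -/
theorem Suzuki2025_eq110_iff_eq19 (h13 : Suzuki2025_prop13) :
    (∀ ψ ∈ suzukiVcirc, ∀ ψ₀ : ℝ → ℂ, IsWeilTest ψ₀ → IsVcircRep ψ₀ ψ →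
        ((2 * ‖ψ‖ ^ 2 : ℝ) : ℂ) = weilQuadratic ψ₀) ↔
      ∀ ψ₀ : ℝ → ℂ, IsWeilTest ψ₀ →
        ((∫ x : ℝ, ‖screwPhat (suzukiD ψ₀) x‖ ^ 2 : ℝ) : ℂ) = Real.pi * weilQuadratic ψ₀ := by
  have hπ : (Real.pi : ℂ) ≠ 0 := Complex.ofReal_ne_zero.mpr Real.pi_ne_zero
  -- the arithmetic of the two normalisations, for a generated pair
  have key : ∀ {ψ₀ : ℝ → ℂ} {ψ : Lp ℂ 2 (volume : Measure ℝ)}, IsVcircRep ψ₀ ψ →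
      (((2 * ‖ψ‖ ^ 2 : ℝ) : ℂ) = weilQuadratic ψ₀ ↔
        ((∫ x : ℝ, ‖screwPhat (suzukiD ψ₀) x‖ ^ 2 : ℝ) : ℂ) = Real.pi * weilQuadratic ψ₀) := by
    intro ψ₀ ψ h
    have e : ((2 * ‖ψ‖ ^ 2 : ℝ) : ℂ) =
        ((∫ x : ℝ, ‖screwPhat (suzukiD ψ₀) x‖ ^ 2 : ℝ) : ℂ) / (Real.pi : ℂ) := by
      rw [norm_sq_of_isVcircRep h, eq_div_iff hπ]
      push_cast
      field_simp
    rw [e, div_eq_iff hπ, mul_comm]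
  constructor
  · intro h ψ₀ hψ₀
    obtain ⟨ψ, hψV, hrep⟩ := exists_mem_suzukiVcirc h13 hψ₀
    exact (key hrep).1 (h ψ hψV ψ₀ hψ₀ hrep)
  · intro h ψ _ ψ₀ hψ₀ hrep
    exact (key hrep).2 (h ψ₀ hψ₀)

/-- **CJM Cor. 1.5 from Thm. 1.4** (and Prop. 1.3): the printed derivation, PROVED as glue — so the
typed `Suzuki2025_cor15` carries no content beyond the facts `Suzuki2025_thm14` (RH-EQUIVALENT·PRINTED)
and `Suzuki2025_prop13` (RH-FREE). [cite: Suzuki2025WeilHilbertSpace, CJM Cor. 1.5 p. 3, proof §4.3 p. 12 (TeX l.1352–1380)] -/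
theorem Suzuki2025_cor15_of (h13 : Suzuki2025_prop13) (h14 : Suzuki2025_thm14) :
    Suzuki2025_cor15 :=
  h14.trans (Suzuki2025_eq110_iff_eq19 h13).symm

/-- Conversely Thm. 1.4 from Cor. 1.5 (and Prop. 1.3): the two criteria are the same statement in
the kernel. [cite: Suzuki2025WeilHilbertSpace, CJM Cor. 1.5 p. 3 (TeX l.436: "Equation (1.9) is reformulated")] -/
theorem Suzuki2025_thm14_of_cor15 (h13 : Suzuki2025_prop13) (h15 : Suzuki2025_cor15) :
    Suzuki2025_thm14 :=
  h15.trans (Suzuki2025_eq110_iff_eq19 h13)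

/-- **The RH-free half of CJM Cor. 1.5: (1.10) on `V°(0)` implies RH** ("by the same argument as
the second half of the proof of Theorem 4.4", i.e. Weil negativity at an off-line zero). In the
tree's words: (1.10) makes `⟨ψ₀,ψ₀⟩_W = 2‖𝖥⁻¹P̂_{Dψ₀}‖² ≥ 0` for every test function `ψ₀`
(each one generates an element, by Prop. 1.3), i.e. Weil positivity, and RH follows from Weil's
criterion (`weil_criterion_holds`, COLUMN 2). RH-FREE, PROVED modulo the RH-free fact
`Suzuki2025_prop13`; the door of this criterion is exactly Weil's.
[cite: Suzuki2025WeilHilbertSpace, CJM proof of Cor. 1.5 §4.3 p. 12 (TeX l.1353–1354: "by the same argument as the second half of the proof of Theorem 4.4") and proof of Thm. 4.4 (TeX l.1303–1337)] -/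
theorem Suzuki2025_cor15_if (h13 : Suzuki2025_prop13)
    (h : ∀ ψ ∈ suzukiVcirc, ∀ ψ₀ : ℝ → ℂ, IsWeilTest ψ₀ → IsVcircRep ψ₀ ψ →
      ((2 * ‖ψ‖ ^ 2 : ℝ) : ℂ) = weilQuadratic ψ₀) :
    RiemannHypothesis := by
  have hW : Summit.RiemannHypothesis.RiemannHypothesis.WeilPositivity := by
    intro g hg
    obtain ⟨ψ, hψV, hrep⟩ := exists_mem_suzukiVcirc h13 hg
    rw [← h ψ hψV g hg hrep, Complex.ofReal_re]
    positivity
  exact (show RiemannHypothesis ↔ Summit.RiemannHypothesis.RiemannHypothesis.WeilPositivity from weil_criterion_holds).mpr hW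

end Literature.NumberTheory.LFunctions
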